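import Literature.Barriers.CriticalPhenomena.PlaquetteWalkHoleRootUniversalDirections
import Literature.Probability.RandomPlanarGeometry.YangBaxterSAWPositivityRange
import HarnessLib

/-!
# Barrier catalogue (SAWScalingLimit): LETTER LAWS — the cancellation geometry of the Yang–Baxter vertex defect of a
hole root at an ARBITRARY cell (letters = table direction × sector unit; two-letter laws; one-direction sector laws)

Companion of `PlaquetteWalkHoleRootUniversalDirections` (this catalogue: THE UNIVERSAL CELL LAW
`VF_D(w.side W, c) = i·v(θ)·Σ_{ω ∈ B2a(c)} woundMassAt(ω)·dirAt(ω)·phase(2π·sectorOf(ω))` at every cell `c` of a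
`W`-normalised hole root — root = the `W` side of `w`, hole `(w.1 − 1, w.2) ∉ D` —, the universal cone law and the
aligned law; tool notions `ΩG.dirAt` = the table direction `dir₀(θ; z₀, z₁, z₂)` of the walk's pattern and `ΩG.sectorOf`
= its sector `k`, `phase(2πk) = ζ^k`, `ζ = e^{−i5π/4}`). Call the unit complex number
`letterAt(ω) = dirAt(ω)·phase(2π·sectorOf(ω))` the LETTER of a wound class-`B2a` walk (sixteen constant and sixteen
rotating letters exist: `ΩG.classTerm_mem_alphabet`), `M(u)` = `ΩG.letterMass` the total wound mass of the walks with
letter `u`, and `M_n` = `ΩG.sectorMass` the total wound mass of the walks with sector `n`. This file records what the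
universal cell law says about CANCELLATION — when can `VF` vanish although wound walks exist — in terms of the set of
letters realised at the cell (all statements for `θ ∈ [π/3, 2π/3]`, non-vanishing / zero sets on the open range):

* ★★★ `PlaquetteWalk.vertexFunctional_printed_cell_eq_sum_letterMass` — THE LETTER LAW: if the wound walks' letters lie
  in a finite set `U` then `VF = i·v(θ)·Σ_{u ∈ U} u·M(u)`; `…_eq_dir_mul_sum_sectorMass` — THE SECTOR LAW: one table
  direction `u` and sectors in `S` ⇒ `VF = i·v(θ)·u·Σ_{n ∈ S} ζ^n·M_n`; `…_eq_zero_of_no_wound` (no wound walk ⇒ `VF = 0`).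
* ★★★ TWO LETTERS (`…_eq_two_letters`, `VF = i·v·(u₁M(u₁) + u₂M(u₂))`): THE NON-ANTIPODAL TWO-LETTER LAW
  `…_ne_zero_of_two_letters` / `…_ne_zero_iff_of_two_letters` — letters of equal modulus with `u₁ + u₂ ≠ 0` NEVER cancel:
  `VF ≠ 0 ↔` a wound walk exists (proof: the rotation `conj(u₁ + u₂)` puts both letters in the open right half-plane,
  `2·Re(conj(u₁+u₂)·u₁) = |u₁|² − |u₂|² + |u₁ + u₂|²`, and the universal cone law applies); THE ANTIPODAL TWO-LETTER LAW
  `…_eq_of_antipodal_letters` (`VF = i·v·u·(M(u) − M(−u))`) with zero set `…_eq_zero_iff_of_antipodal_letters`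
  (`VF = 0 ↔ M(u) = M(−u)`) — the common shape of the catalogue's far-cell, lateral and three-door laws.
* ★★★ ONE TABLE DIRECTION, TWO SECTORS `n₁, n₂`: `phase_two_pi_mul_eq_neg_one_iff` (`ζ^d = −1 ↔ d ≡ 4 (mod 8)`), so
  THE NON-ANTIPODAL TWO-SECTOR LAW `…_ne_zero_of_two_sectors` / `…_ne_zero_iff_of_two_sectors`: `n₂ − n₁ ≢ 4 (mod 8)` ⇒
  (`VF ≠ 0 ↔` a wound walk exists) — in particular ADJACENT sectors never cancel; THE ANTIPODAL TWO-SECTOR LAW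
  `…_eq_of_antipodal_sectors` (`n₂ − n₁ ≡ 4`: `VF = i·v·u·ζ^{n₁}·(M_{n₁} − M_{n₂})`), zero set `…_eq_zero_iff_of_antipodal_sectors`.
* ★★★ ONE TABLE DIRECTION, THREE CONSECUTIVE SECTORS `n₀ − 1, n₀, n₀ + 1` (masses `M₋, M₀, M₊`): THE THREE-SECTOR LAW
  `…_eq_of_three_sectors` (`VF = i·v·u·ζ^{n₀}·(M₀ + ζM₊ + ζ⁻¹M₋)`), its Cartesian form `…_cartesian`
  (`M₀ + ζM₊ + ζ⁻¹M₋ = (M₀ − (M₊ + M₋)/√2) + i(M₊ − M₋)/√2`, from `phase_two_pi` / `phase_neg_two_pi`: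
  `ζ^{±1} = (−1 ± i)/√2`), the ZERO SET `…_eq_zero_iff_of_three_sectors` (`VF = 0 ↔ M₊ = M₋ ∧ M₀ = √2·M₊` — two real
  conditions, codimension two), and the non-vanishing corollaries `…_ne_zero_of_three_sectors_dominant`
  (`M₊ + M₋ < √2·M₀`), `…_subdominant` (`√2·M₀ < M₊ + M₋`), `…_of_ne` (`M₊ ≠ M₋`).
* plumbing: `ΩG.letterAt`, `ΩG.letterMass`, `ΩG.sectorMass` (tool notions, junk-free on wound walks), `ΩG.norm_letterAt`
  (`|letter| = 1`), `ΩG.sum_eq_sum_letterMass` / `ΩG.sum_eq_dir_mul_sum_sectorMass` (the regroupings of the universal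
  sum), `phase_two_pi_mul_add_eight_mul` (only the sector's residue mod `8` matters), `phase_two_pi_mul_eq_mul_sub`.

* ★★★ (edition 2) LINEAR CERTIFICATES: `…_ne_zero_of_linear_certificate` (any ρ with Σ_u Re(conj ρ·u)·M(u) > 0 ⇒ VF ≠ 0),
  `…_ne_zero_of_cone_dominance` (unit ρ, level κ: κ·(mass of letters with Re(conj ρ·u) ≥ κ) > mass of the rest ⇒ VF ≠ 0), and the
  DEFECT EFFICIENCY bound `norm_vertexFunctional_printed_cell_ge_linear` (‖VF‖ ≥ v·Σ_u Re(conj ρ·u)·M(u) for unit ρ) — the Lean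
  interface of the venture lane's all-θ certificates (HOME FINDING-YB-ENCIRCLING-ALLTHETA-CENSUS: efficiency ≥ 0.887 at every
  cell with ≥ 3 letters of the boxes up to 6 × 7).
* ★★★ (edition 3) THE EIGHT-RESIDUE LAW (one table direction, ARBITRARY sectors): `phase_two_pi_mul_emod_eight` (only the residue of
  the sector mod 8 matters), the eight powers `phase_two_pi_mul_{zero,…,seven}_real` (`ζ^j`, `j = 0..7`: `1, (−1+i)/√2, −i, (1+i)/√2,
  −1, (1−i)/√2, i, (−1−i)/√2`), the residue masses `ΩG.residueMass` `R_j`, the regrouping `ΩG.sum_eq_dir_mul_sum_residueMass`, and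
  `…_eq_dir_mul_sum_residueMass` / `…_eq_residue_cartesian`: `VF = i·v·u·Σ_j ζ^j R_j =
  i·v·u·[((R₀ − R₄) + (R₃ + R₅ − R₁ − R₇)/√2) + i((R₆ − R₂) + (R₁ + R₃ − R₅ − R₇)/√2)]` — at a one-pattern cell the defect is a
  function of eight numbers, and its zero set is two real linear conditions on them (sectors themselves are unbounded:
  HOME FINDING-YB-SECTOR-UNBOUNDED realises all eight residues at one cell).
* ★★★ (edition 4) THE TWO-CONDITIONS LAW `…_eq_zero_iff_re_im` (on the open range `VF = 0 ↔ Σ_u Re(u)·M(u) = 0 ∧ Σ_u Im(u)·M(u) = 0` —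
  the zero set at any cell is two real linear conditions on the letter masses) and COMPLETENESS OF LINEAR CERTIFICATES
  `…_ne_zero_iff_exists_linear_certificate` (`VF ≠ 0 ↔ ∃ ρ, 0 < Σ_u Re(conj ρ·u)·M(u)`; `ρ = S` works).
* ★★ (edition 5) ENDPOINT ZERO-MASS LAWS `…_pi_div_three_eq_zero_of_coCorner_faces` / `…_two_pi_div_three_eq_zero_of_corner_faces`: at
  `θ = π/3` (resp. `2π/3`) a cell all of whose wound class-`B2a` walks visit a rhombus with two co-corner (resp. two `θ`-corner) arcs has `VF = 0`,
  because `w₂(π/3) = 0` (`weightW2_pi_div_three`, topic file) resp. `w₁(2π/3) = 0` (`weightW1_two_pi_div_three`, topic file `YangBaxterSAWPositivityRange`, now imported) kills every wound mass —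
  zero MASS, not cancellation (the only non-far-cell zeros of the venture lane's 25-domain census are of this kind).
So at a cell where the wound walks realise one letter (aligned law), two non-opposite letters, or one pattern in two
sectors not differing by `4` mod `8`, the sufficient half of the encircling criterion holds on the whole open range —
the defect vanishes iff no wound walk exists; cancellation needs two antipodal letters (one real balance condition) or
at least three letters (for three consecutive sectors of one pattern: two real conditions). Which letters occur at a
given cell of a given domain is a finite combinatorial datum not decided here (venture lane «pcv-sawmu»: in exact
enumeration of boxes up to `6 × 7` the wound walks at a second-ring cell below or beside the hole realise one pattern in
the sectors `{0, 1}` or `{−1, 0, 1}`, HOME `FINDING-YB-SECOND-RING-SECTORS`; sectors are unbounded in general,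
HOME `FINDING-YB-SECTOR-UNBOUNDED`). Elementary given the parent (venture lane «pcv-sawmu», b-step0 gen 22).
References, as printed: A. Glazman, I. Manolescu, arXiv:1708.00395v3, Lemma 2.1 (p. 6, «in the form given in [Gl]»)
and §2.1 (the parafermionic observable, σ = 5/8) [GlazmanManolescu2019]; A. Glazman, Electron. Commun. Probab. 20 (2015)
no. 86, Lemma 3.1 and its proof pp. 6–7, eq. (1) (the weights) [Glazman2015WeightedSAW]. Status: lane corollaries of the
universal cell law; not located in print (hole roots are outside the printed simply connected setting). NOT claimed: which
letters occur at which cells; any sign or size of the masses; anything at the endpoints `θ = π/3, 2π/3` beyond the identities.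
-/

noncomputable section

namespace Literature.Probability.RandomPlanarGeometry.SAW.YangBaxter

open Real Complex

/-! ## The sector unit `ζ = phase(2π) = e^{−i5π/4}` and its powers -/

section SectorUnit

/-- `phase(2π(n + 8m)) = phase(2πn)`: the sector enters the class term only through its residue mod `8`
(`ζ⁸ = 1`, `ζ = e^{−i5π/4}`). [cite: GlazmanManolescu2019, §2.1 (the parafermionic weight, σ = 5/8)] -/
theorem phase_two_pi_mul_add_eight_mul (n m : ℤ) : phase (2 * π * ((n + 8 * m : ℤ) : ℝ)) = phase (2 * π * n) := by
  rw [phase_two_pi_mul_int, phase_two_pi_mul_int, Complex.exp_eq_exp_iff_exists_int]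
  refine ⟨-5 * m, ?_⟩
  push_cast; ring

/-- `phase(2π·n₂) = phase(2π·n₁)·phase(2π(n₂ − n₁))`. [cite: GlazmanManolescu2019, §2.1 (σ = 5/8)] -/
theorem phase_two_pi_mul_eq_mul_sub (n₁ n₂ : ℤ) :
    phase (2 * π * n₂) = phase (2 * π * n₁) * phase (2 * π * ((n₂ - n₁ : ℤ) : ℝ)) := by
  rw [← phase_add]; congr 1; push_cast; ring

/-- `phase(2πd) = −1` exactly when `d ≡ 4 (mod 8)`: two sectors give ANTIPODAL letters iff they differ by `4` mod `8`.
[cite: GlazmanManolescu2019, §2.1 (the parafermionic weight, σ = 5/8)] -/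
theorem phase_two_pi_mul_eq_neg_one_iff (d : ℤ) : phase (2 * π * d) = -1 ↔ d % 8 = 4 := by
  rw [phase_two_pi_mul_int, ← Complex.exp_pi_mul_I, Complex.exp_eq_exp_iff_exists_int]
  constructor
  · rintro ⟨m, hm⟩
    have h1 : ((-(5 * π * d / 4) : ℝ) : ℂ) = (π : ℂ) * (1 + 2 * m) := by
      have := hm
      have hI : Complex.I ≠ 0 := Complex.I_ne_zero
      have e : ((-(5 * π * d / 4) : ℝ) : ℂ) * Complex.I = ((π : ℂ) * (1 + 2 * m)) * Complex.I := by
        rw [this]; ring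
      exact mul_right_cancel₀ hI e
    have h2 : (-(5 * π * d / 4) : ℝ) = π * (1 + 2 * m) := by exact_mod_cast h1
    have h3 : (-(5 * (d : ℝ))) = 4 * (1 + 2 * m) := by
      have hπ : (π : ℝ) ≠ 0 := Real.pi_ne_zero
      field_simp at h2
      linarith
    have h4 : -(5 * d) = 4 * (1 + 2 * m) := by exact_mod_cast h3
    omega
  · intro h
    refine ⟨-(5 * (d / 8) + 3), ?_⟩
    have hd : d = 8 * (d / 8) + 4 := by omega
    have e : (-(5 * π * d / 4) : ℝ) = π + (((-(5 * (d / 8) + 3) : ℤ) : ℝ)) * (2 * π) := by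
      conv_lhs => rw [hd]
      push_cast; ring
    rw [e]; push_cast; ring

/-- The value of the sector unit: `phase(2π) = e^{−i5π/4} = (−1 + i)/√2`. [cite: GlazmanManolescu2019, §2.1 (σ = 5/8)] -/
theorem phase_two_pi : phase (2 * π) = ⟨-(Real.sqrt 2 / 2), Real.sqrt 2 / 2⟩ := by
  have e : phase (2 * π) = Complex.exp ((-(5 * π / 4) : ℝ) * Complex.I) := by
    rw [phase]; congr 2; push_cast; ring
  have hc : Real.cos (-(5 * π / 4)) = -(Real.sqrt 2 / 2) := by
    rw [Real.cos_neg, show 5 * π / 4 = π / 4 + π by ring, Real.cos_add_pi, Real.cos_pi_div_four]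
  have hs : Real.sin (-(5 * π / 4)) = Real.sqrt 2 / 2 := by
    rw [Real.sin_neg, show 5 * π / 4 = π / 4 + π by ring, Real.sin_add_pi, Real.sin_pi_div_four]; ring
  rw [e, Complex.exp_mul_I, ← Complex.ofReal_cos, ← Complex.ofReal_sin, hc, hs]
  apply Complex.ext <;> simp

/-- `phase(−2π) = e^{i5π/4} = (−1 − i)/√2`. [cite: GlazmanManolescu2019, §2.1 (σ = 5/8)] -/
theorem phase_neg_two_pi : phase (-(2 * π)) = ⟨-(Real.sqrt 2 / 2), -(Real.sqrt 2 / 2)⟩ := by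
  have e : phase (-(2 * π)) = Complex.exp (((5 * π / 4) : ℝ) * Complex.I) := by
    rw [phase]; congr 2; push_cast; ring
  have hc : Real.cos (5 * π / 4) = -(Real.sqrt 2 / 2) := by
    rw [show 5 * π / 4 = π / 4 + π by ring, Real.cos_add_pi, Real.cos_pi_div_four]
  have hs : Real.sin (5 * π / 4) = -(Real.sqrt 2 / 2) := by
    rw [show 5 * π / 4 = π / 4 + π by ring, Real.sin_add_pi, Real.sin_pi_div_four]
  rw [e, Complex.exp_mul_I, ← Complex.ofReal_cos, ← Complex.ofReal_sin, hc, hs]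
  apply Complex.ext <;> simp

end SectorUnit

/-! ## Letters, letter masses and sector masses at a cell of a `W`-normalised hole root -/

namespace ΩG

variable {D : Set Face} {w r : Face}

/-- Tool notion: **the letter of a walk** — its table direction turned by its sector unit,
`letterAt = dirAt·phase(2π·sectorOf)` (so that a wound class term is `v·ext·letterAt`; junk on other walks).
[cite: GlazmanManolescu2019, Lemma 2.1 (statement, "in the form given in [Gl]") and §2.1 (σ = 5/8)] -/
noncomputable def letterAt (hh : ((w.1 - 1, w.2) : Face) ∉ D) (θ : ℝ) (hr : RootedFace D (w.side .W) r)
    (ω : ΩG D (w.side .W) r) : ℂ :=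
  dirAt θ hr ω * phase (2 * π * sectorOf hh θ hr ω)

/-- A walk with non-zero wound mass is a WOUND class-`B2a` walk. [cite: Glazman2015WeightedSAW, Lemma 3.1 (proof, pp. 6–7)] -/
theorem exists_wound_of_woundMassAt_ne_zero {θ : ℝ} {a : MidEdge} (hr : RootedFace D a r) (ω : ΩG D a r)
    (hm : woundMassAt θ hr ω ≠ 0) :
    ∃ h : ω.IsB2a, ω.WE (fun _ => θ) ≠ excursionWinding θ ω.2.firstSideG (ω.z1 hr h) ω.1 := by
  unfold woundMassAt at hm
  by_cases h : ω.IsB2a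
  · rw [dif_pos h] at hm
    by_cases hW : ω.WE (fun _ => θ) ≠ excursionWinding θ ω.2.firstSideG (ω.z1 hr h) ω.1
    · exact ⟨h, hW⟩
    · rw [if_neg hW] at hm; exact absurd rfl hm
  · rw [dif_neg h] at hm; exact absurd rfl hm

/-- The wound mass of a wound class-`B2a` walk is its exterior weight. [cite: Glazman2015WeightedSAW, Lemma 3.1 (proof, pp. 6–7)] -/
theorem woundMassAt_of_wound {θ : ℝ} {a : MidEdge} (hr : RootedFace D a r) (ω : ΩG D a r) (h : ω.IsB2a)
    (hW : ω.WE (fun _ => θ) ≠ excursionWinding θ ω.2.firstSideG (ω.z1 hr h) ω.1) :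
    woundMassAt θ hr ω = ω.2.extWeight (fun _ => θ) r := by
  unfold woundMassAt; rw [dif_pos h, if_pos hW]

/-- The letter of a wound class-`B2a` walk is a unit complex number. [cite: GlazmanManolescu2019, Lemma 2.1 (statement)] -/
theorem norm_letterAt (hh : ((w.1 - 1, w.2) : Face) ∉ D) (θ : ℝ) (hr : RootedFace D (w.side .W) r)
    (ω : ΩG D (w.side .W) r) (h : ω.IsB2a) : ‖letterAt hh θ hr ω‖ = 1 := by
  obtain ⟨hz01, hz02, hz12⟩ := ω.firstSide_exit_return_distinct hr h
  rw [letterAt, norm_mul, dirAt, dif_pos h, norm_dirZero θ hz01 hz02 hz12, one_mul, phase_two_pi_mul_int,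
    Complex.norm_exp_ofReal_mul_I]

variable [Finite D]

open Classical in
/-- Tool notion: **the letter mass** `M(u)` — the total wound mass of the class-`B2a` walks at `r` whose letter is `u`.
[cite: Glazman2015WeightedSAW, Lemma 3.1 (proof, pp. 6–7: the classes of walks through a rhombus)] -/
noncomputable def letterMass (hh : ((w.1 - 1, w.2) : Face) ∉ D) (θ : ℝ) (hr : RootedFace D (w.side .W) r) (u : ℂ) : ℝ :=
  ∑ ω ∈ setB2a D (w.side .W) r, if letterAt hh θ hr ω = u then woundMassAt θ hr ω else 0

/-- Tool notion: **the sector mass** `M_n` — the total wound mass of the class-`B2a` walks at `r` whose sector is `n`.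
[cite: GlazmanManolescu2019, §2.1, eq. (2.1) (wind(γ)) and Lemma 2.1] -/
noncomputable def sectorMass (hh : ((w.1 - 1, w.2) : Face) ∉ D) (θ : ℝ) (hr : RootedFace D (w.side .W) r) (n : ℤ) : ℝ :=
  ∑ ω ∈ setB2a D (w.side .W) r, if sectorOf hh θ hr ω = n then woundMassAt θ hr ω else 0

/-- Letter masses are non-negative on the printed range. [cite: GlazmanManolescu2019, eq. (1) (the weights are non-negative)] -/
theorem letterMass_nonneg (hh : ((w.1 - 1, w.2) : Face) ∉ D) {θ : ℝ} (hθ : θ ∈ Set.Icc (π / 3) (2 * π / 3))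
    (hr : RootedFace D (w.side .W) r) (u : ℂ) : 0 ≤ letterMass hh θ hr u := by
  classical
  unfold letterMass
  exact Finset.sum_nonneg fun ω _ => by split_ifs; exacts [woundMassAt_nonneg hθ hr ω, le_rfl]

/-- Sector masses are non-negative on the printed range. [cite: GlazmanManolescu2019, eq. (1) (the weights are non-negative)] -/
theorem sectorMass_nonneg (hh : ((w.1 - 1, w.2) : Face) ∉ D) {θ : ℝ} (hθ : θ ∈ Set.Icc (π / 3) (2 * π / 3))
    (hr : RootedFace D (w.side .W) r) (n : ℤ) : 0 ≤ sectorMass hh θ hr n := by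
  unfold sectorMass
  exact Finset.sum_nonneg fun ω _ => by split_ifs; exacts [woundMassAt_nonneg hθ hr ω, le_rfl]

/-- ★★ **LETTER DECOMPOSITION of the universal sum.** If every WOUND class-`B2a` walk at `r` has its letter in the finite
set `U`, then `Σ_{B2a} woundMassAt·dirAt·phase(2π·sectorOf) = Σ_{u ∈ U} u·M(u)`.
[cite: GlazmanManolescu2019, Lemma 2.1 (statement, "in the form given in [Gl]")] [cite: Glazman2015WeightedSAW, Lemma 3.1 (proof, pp. 6–7)] -/
theorem sum_eq_sum_letterMass (hh : ((w.1 - 1, w.2) : Face) ∉ D) (θ : ℝ) (hr : RootedFace D (w.side .W) r)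
    (U : Finset ℂ)
    (hU : ∀ (ω : ΩG D (w.side .W) r) (h : ω.IsB2a),
      ω.WE (fun _ => θ) ≠ excursionWinding θ ω.2.firstSideG (ω.z1 hr h) ω.1 → letterAt hh θ hr ω ∈ U) :
    ∑ ω ∈ setB2a D (w.side .W) r,
        (woundMassAt θ hr ω : ℂ) * dirAt θ hr ω * phase (2 * π * sectorOf hh θ hr ω) =
      ∑ u ∈ U, u * (letterMass hh θ hr u : ℂ) := by
  classical
  have step : ∀ ω ∈ setB2a D (w.side .W) r,
      (woundMassAt θ hr ω : ℂ) * dirAt θ hr ω * phase (2 * π * sectorOf hh θ hr ω) =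
        ∑ u ∈ U, u * ((if letterAt hh θ hr ω = u then woundMassAt θ hr ω else 0 : ℝ) : ℂ) := by
    intro ω _
    by_cases hm : woundMassAt θ hr ω = 0
    · rw [hm]; simp
    · obtain ⟨h, hW⟩ := exists_wound_of_woundMassAt_ne_zero hr ω hm
      have hmem := hU ω h hW
      have e : ∀ u ∈ U, u * ((if letterAt hh θ hr ω = u then woundMassAt θ hr ω else 0 : ℝ) : ℂ) =
          if letterAt hh θ hr ω = u then letterAt hh θ hr ω * (woundMassAt θ hr ω : ℂ) else 0 := by
        intro u _
        split_ifs with hu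
        · rw [hu]
        · simp
      rw [Finset.sum_congr rfl e, Finset.sum_ite_eq U (letterAt hh θ hr ω), if_pos hmem, letterAt]; ring
  rw [Finset.sum_congr rfl step, Finset.sum_comm]
  refine Finset.sum_congr rfl fun u _ => ?_
  rw [letterMass, Complex.ofReal_sum, Finset.mul_sum]

/-- ★★ **SECTOR DECOMPOSITION of the universal sum (one direction).** If every WOUND class-`B2a` walk at `r` has table
direction `u` and sector in the finite set `S`, then `Σ_{B2a} woundMassAt·dirAt·phase(2π·sectorOf) = u·Σ_{n ∈ S} phase(2πn)·M_n`.
[cite: GlazmanManolescu2019, Lemma 2.1 (statement) and §2.1 (σ = 5/8)] [cite: Glazman2015WeightedSAW, Lemma 3.1 (proof, pp. 6–7)] -/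
theorem sum_eq_dir_mul_sum_sectorMass (hh : ((w.1 - 1, w.2) : Face) ∉ D) (θ : ℝ) (hr : RootedFace D (w.side .W) r)
    (u : ℂ) (S : Finset ℤ)
    (hdir : ∀ (ω : ΩG D (w.side .W) r) (h : ω.IsB2a),
      ω.WE (fun _ => θ) ≠ excursionWinding θ ω.2.firstSideG (ω.z1 hr h) ω.1 → dirAt θ hr ω = u)
    (hS : ∀ (ω : ΩG D (w.side .W) r) (h : ω.IsB2a),
      ω.WE (fun _ => θ) ≠ excursionWinding θ ω.2.firstSideG (ω.z1 hr h) ω.1 → sectorOf hh θ hr ω ∈ S) :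
    ∑ ω ∈ setB2a D (w.side .W) r,
        (woundMassAt θ hr ω : ℂ) * dirAt θ hr ω * phase (2 * π * sectorOf hh θ hr ω) =
      u * ∑ n ∈ S, phase (2 * π * n) * (sectorMass hh θ hr n : ℂ) := by
  classical
  have step : ∀ ω ∈ setB2a D (w.side .W) r,
      (woundMassAt θ hr ω : ℂ) * dirAt θ hr ω * phase (2 * π * sectorOf hh θ hr ω) =
        u * ∑ n ∈ S, phase (2 * π * n) * ((if sectorOf hh θ hr ω = n then woundMassAt θ hr ω else 0 : ℝ) : ℂ) := by
    intro ω _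
    by_cases hm : woundMassAt θ hr ω = 0
    · rw [hm]; simp
    · obtain ⟨h, hW⟩ := exists_wound_of_woundMassAt_ne_zero hr ω hm
      have hmem := hS ω h hW
      have e : ∀ n ∈ S, phase (2 * π * n) * ((if sectorOf hh θ hr ω = n then woundMassAt θ hr ω else 0 : ℝ) : ℂ) =
          if sectorOf hh θ hr ω = n then phase (2 * π * sectorOf hh θ hr ω) * (woundMassAt θ hr ω : ℂ) else 0 := by
        intro n _
        split_ifs with hn
        · rw [hn]
        · simp
      rw [Finset.sum_congr rfl e, Finset.sum_ite_eq S (sectorOf hh θ hr ω), if_pos hmem, hdir ω h hW]; ring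
  rw [Finset.sum_congr rfl step, ← Finset.mul_sum, Finset.sum_comm]
  congr 1
  refine Finset.sum_congr rfl fun n _ => ?_
  rw [sectorMass, Complex.ofReal_sum, Finset.mul_sum]

/-- Without a wound walk every letter mass vanishes. [cite: Glazman2015WeightedSAW, Lemma 3.1 (proof, pp. 6–7)] -/
theorem letterMass_eq_zero_of_no_wound (hh : ((w.1 - 1, w.2) : Face) ∉ D) (θ : ℝ) (hr : RootedFace D (w.side .W) r)
    (u : ℂ)
    (hno : ∀ (ω : ΩG D (w.side .W) r) (h : ω.IsB2a),
      ω.WE (fun _ => θ) = excursionWinding θ ω.2.firstSideG (ω.z1 hr h) ω.1) :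
    letterMass hh θ hr u = 0 := by
  classical
  unfold letterMass
  refine Finset.sum_eq_zero fun ω _ => ?_
  have hm : woundMassAt θ hr ω = 0 := by
    by_contra hm
    obtain ⟨h, hW⟩ := exists_wound_of_woundMassAt_ne_zero hr ω hm
    exact hW (hno ω h)
  simp [hm]

/-- Without a wound walk every sector mass vanishes. [cite: Glazman2015WeightedSAW, Lemma 3.1 (proof, pp. 6–7)] -/
theorem sectorMass_eq_zero_of_no_wound (hh : ((w.1 - 1, w.2) : Face) ∉ D) (θ : ℝ) (hr : RootedFace D (w.side .W) r)
    (n : ℤ)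
    (hno : ∀ (ω : ΩG D (w.side .W) r) (h : ω.IsB2a),
      ω.WE (fun _ => θ) = excursionWinding θ ω.2.firstSideG (ω.z1 hr h) ω.1) :
    sectorMass hh θ hr n = 0 := by
  unfold sectorMass
  refine Finset.sum_eq_zero fun ω _ => ?_
  have hm : woundMassAt θ hr ω = 0 := by
    by_contra hm
    obtain ⟨h, hW⟩ := exists_wound_of_woundMassAt_ne_zero hr ω hm
    exact hW (hno ω h)
  simp [hm]

end ΩG

/-! ## A Hermitian-form inequality: two letters of equal length that are not antipodal lie in an open half-plane -/

/-- `2·Re(conj(a + b)·a) = |a|² − |b|² + |a + b|²`. [folklore] -/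
private theorem two_mul_re_conj_add_mulL (a b : ℂ) :
    2 * ((starRingEnd ℂ) (a + b) * a).re = Complex.normSq a - Complex.normSq b + Complex.normSq (a + b) := by
  simp only [Complex.mul_re, Complex.conj_re, Complex.conj_im, Complex.add_re, Complex.add_im, Complex.normSq_apply]
  ring

/-- Two complex numbers of equal modulus with `a + b ≠ 0` both have positive real part after rotation by `conj(a + b)`.
[folklore] -/
private theorem re_conj_add_mul_posL {a b : ℂ} (hn : ‖a‖ = ‖b‖) (hs : a + b ≠ 0) :
    0 < ((starRingEnd ℂ) (a + b) * a).re := by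
  have h1 := two_mul_re_conj_add_mulL a b
  have h2 : Complex.normSq a = Complex.normSq b := by
    rw [Complex.normSq_eq_norm_sq, Complex.normSq_eq_norm_sq, hn]
  have h3 : 0 < Complex.normSq (a + b) := Complex.normSq_pos.2 hs
  linarith

/-- A phase is never zero. [folklore] -/
private theorem phase_ne_zeroL (x : ℝ) : phase x ≠ 0 := by
  rw [phase]; exact Complex.exp_ne_zero _

/-- `‖u·phase(2πn)‖ = ‖u‖`. [folklore] -/
private theorem norm_mul_phase_two_pi_mulL (u : ℂ) (n : ℤ) : ‖u * phase (2 * π * n)‖ = ‖u‖ := by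
  rw [norm_mul, phase_two_pi_mul_int, Complex.norm_exp_ofReal_mul_I, mul_one]

end Literature.Probability.RandomPlanarGeometry.SAW.YangBaxter

/-! ## The letter laws of the vertex defect at an arbitrary cell -/

namespace Literature.Barriers.CriticalPhenomena.PlaquetteWalk

open Literature.Probability.RandomPlanarGeometry.SAW.YangBaxter
open Real Complex

/-- ★★★ **THE LETTER LAW.** At every cell `c` of a `W`-normalised hole root not containing the root, for `θ ∈ [π/3, 2π/3]`:
if every WOUND class-`B2a` walk at `c` has its letter `dirAt·phase(2π·sectorOf)` in the finite set `U`, then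
`VF_D(w.side W, c) = i·v(θ)·Σ_{u ∈ U} u·M(u)` — the vertex defect is `i·v(θ)` times a non-negative combination of the
letters that occur. [cite: GlazmanManolescu2019, Lemma 2.1 (statement, "in the form given in [Gl]") and §2.1 (σ = 5/8)]
[cite: Glazman2015WeightedSAW, Lemma 3.1 (proof, pp. 6–7: the classes of walks through a rhombus)] -/
theorem vertexFunctional_printed_cell_eq_sum_letterMass {θ : ℝ} (hθ : θ ∈ Set.Icc (π / 3) (2 * π / 3))
    (Dl : List Face) (w c : Face) (hf : c ∈ Dl) (hh : ((w.1 - 1, w.2) : Face) ∉ dom Dl)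
    (hc : ∀ t, c.side t ≠ w.side .W) (hr : RootedFace (dom Dl) (w.side .W) c) (U : Finset ℂ)
    (hU : ∀ (ω : ΩG (dom Dl) (w.side .W) c) (h : ω.IsB2a),
      ω.WE (fun _ => θ) ≠ excursionWinding θ ω.2.firstSideG (ω.z1 hr h) ω.1 → ΩG.letterAt hh θ hr ω ∈ U) :
    vertexFunctional (printedWeights θ) tFiveEighths (ybCoeff θ) Dl (w.side .W) c =
      Complex.I * (weightV θ : ℂ) * ∑ u ∈ U, u * (ΩG.letterMass hh θ hr u : ℂ) := by
  rw [vertexFunctional_printed_cell_eq_universal hθ Dl w c hf hh hc hr, ΩG.sum_eq_sum_letterMass hh θ hr U hU]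

/-- ★★★ **THE SECTOR LAW (one table direction).** If every WOUND class-`B2a` walk at `c` has table direction `u`
(e.g. a single pattern `(z₀, {z₁, z₂})` occurs) and sector in the finite set `S`, then
`VF_D(w.side W, c) = i·v(θ)·u·Σ_{n ∈ S} ζ^n·M_n` with `ζ^n = phase(2πn)`, `ζ = e^{−i5π/4}`, and `M_n` the sector masses.
[cite: GlazmanManolescu2019, Lemma 2.1 (statement) and §2.1, eq. (2.1) (wind(γ), σ = 5/8)]
[cite: Glazman2015WeightedSAW, Lemma 3.1 (proof, pp. 6–7)] -/
theorem vertexFunctional_printed_cell_eq_dir_mul_sum_sectorMass {θ : ℝ} (hθ : θ ∈ Set.Icc (π / 3) (2 * π / 3))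
    (Dl : List Face) (w c : Face) (hf : c ∈ Dl) (hh : ((w.1 - 1, w.2) : Face) ∉ dom Dl)
    (hc : ∀ t, c.side t ≠ w.side .W) (hr : RootedFace (dom Dl) (w.side .W) c) (u : ℂ) (S : Finset ℤ)
    (hdir : ∀ (ω : ΩG (dom Dl) (w.side .W) c) (h : ω.IsB2a),
      ω.WE (fun _ => θ) ≠ excursionWinding θ ω.2.firstSideG (ω.z1 hr h) ω.1 → ΩG.dirAt θ hr ω = u)
    (hS : ∀ (ω : ΩG (dom Dl) (w.side .W) c) (h : ω.IsB2a),
      ω.WE (fun _ => θ) ≠ excursionWinding θ ω.2.firstSideG (ω.z1 hr h) ω.1 → ΩG.sectorOf hh θ hr ω ∈ S) :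
    vertexFunctional (printedWeights θ) tFiveEighths (ybCoeff θ) Dl (w.side .W) c =
      Complex.I * (weightV θ : ℂ) * u * ∑ n ∈ S, phase (2 * π * n) * (ΩG.sectorMass hh θ hr n : ℂ) := by
  rw [vertexFunctional_printed_cell_eq_universal hθ Dl w c hf hh hc hr,
    ΩG.sum_eq_dir_mul_sum_sectorMass hh θ hr u S hdir hS]
  ring

/-- **No wound walk, no defect** (the unwound criterion in letter form): if no class-`B2a` walk at `c` is wound then
`VF_D(w.side W, c) = 0`. [cite: GlazmanManolescu2019, Lemma 2.1 (statement, "in the form given in [Gl]")]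
[cite: Glazman2015WeightedSAW, Lemma 3.1 (proof, pp. 6–7)] -/
theorem vertexFunctional_printed_cell_eq_zero_of_no_wound {θ : ℝ} (hθ : θ ∈ Set.Icc (π / 3) (2 * π / 3))
    (Dl : List Face) (w c : Face) (hf : c ∈ Dl) (hh : ((w.1 - 1, w.2) : Face) ∉ dom Dl)
    (hc : ∀ t, c.side t ≠ w.side .W) (hr : RootedFace (dom Dl) (w.side .W) c)
    (hno : ∀ (ω : ΩG (dom Dl) (w.side .W) c) (h : ω.IsB2a),
      ω.WE (fun _ => θ) = excursionWinding θ ω.2.firstSideG (ω.z1 hr h) ω.1) :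
    vertexFunctional (printedWeights θ) tFiveEighths (ybCoeff θ) Dl (w.side .W) c = 0 := by
  rw [vertexFunctional_printed_cell_eq_sum_letterMass hθ Dl w c hf hh hc hr ∅ (fun ω h hW => absurd (hno ω h) hW)]
  simp

/-! ### Two letters -/

/-- ★★★ **THE TWO-LETTER LAW.** If the wound class-`B2a` walks at `c` realise at most two letters `u₁ ≠ u₂`, then
`VF_D(w.side W, c) = i·v(θ)·(u₁·M(u₁) + u₂·M(u₂))`. [cite: GlazmanManolescu2019, Lemma 2.1 (statement) and §2.1 (σ = 5/8)]
[cite: Glazman2015WeightedSAW, Lemma 3.1 (proof, pp. 6–7)] -/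
theorem vertexFunctional_printed_cell_eq_two_letters {θ : ℝ} (hθ : θ ∈ Set.Icc (π / 3) (2 * π / 3))
    (Dl : List Face) (w c : Face) (hf : c ∈ Dl) (hh : ((w.1 - 1, w.2) : Face) ∉ dom Dl)
    (hc : ∀ t, c.side t ≠ w.side .W) (hr : RootedFace (dom Dl) (w.side .W) c) {u₁ u₂ : ℂ} (hne : u₁ ≠ u₂)
    (h2 : ∀ (ω : ΩG (dom Dl) (w.side .W) c) (h : ω.IsB2a),
      ω.WE (fun _ => θ) ≠ excursionWinding θ ω.2.firstSideG (ω.z1 hr h) ω.1 →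
        ΩG.letterAt hh θ hr ω = u₁ ∨ ΩG.letterAt hh θ hr ω = u₂) :
    vertexFunctional (printedWeights θ) tFiveEighths (ybCoeff θ) Dl (w.side .W) c =
      Complex.I * (weightV θ : ℂ) *
        (u₁ * (ΩG.letterMass hh θ hr u₁ : ℂ) + u₂ * (ΩG.letterMass hh θ hr u₂ : ℂ)) := by
  classical
  rw [vertexFunctional_printed_cell_eq_sum_letterMass hθ Dl w c hf hh hc hr {u₁, u₂}
    (fun ω h hW => by rcases h2 ω h hW with e | e <;> simp [e]), Finset.sum_pair hne]

/-- ★★★ **THE NON-ANTIPODAL TWO-LETTER LAW (no cancellation).** On `θ ∈ (π/3, 2π/3)`: if the wound class-`B2a` walks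
at `c` realise at most two letters `u₁, u₂` of equal modulus with `u₁ + u₂ ≠ 0` (not antipodal), then `VF_D(w.side W, c) ≠ 0`
as soon as one wound walk exists — two letters cancel only when they are exactly opposite.
[cite: GlazmanManolescu2019, Lemma 2.1 (statement, "in the form given in [Gl]")] [cite: Glazman2015WeightedSAW, Lemma 3.1 (proof, pp. 6–7)] -/
theorem vertexFunctional_printed_cell_ne_zero_of_two_letters {θ : ℝ} (hθ : θ ∈ Set.Ioo (π / 3) (2 * π / 3))
    (Dl : List Face) (w c : Face) (hf : c ∈ Dl) (hh : ((w.1 - 1, w.2) : Face) ∉ dom Dl)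
    (hc : ∀ t, c.side t ≠ w.side .W) (hr : RootedFace (dom Dl) (w.side .W) c) {u₁ u₂ : ℂ} (hn : ‖u₁‖ = ‖u₂‖)
    (hsum : u₁ + u₂ ≠ 0)
    (h2 : ∀ (ω : ΩG (dom Dl) (w.side .W) c) (h : ω.IsB2a),
      ω.WE (fun _ => θ) ≠ excursionWinding θ ω.2.firstSideG (ω.z1 hr h) ω.1 →
        ΩG.letterAt hh θ hr ω = u₁ ∨ ΩG.letterAt hh θ hr ω = u₂)
    (hex : ∃ (ω : ΩG (dom Dl) (w.side .W) c) (h : ω.IsB2a),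
      ω.WE (fun _ => θ) ≠ excursionWinding θ ω.2.firstSideG (ω.z1 hr h) ω.1) :
    vertexFunctional (printedWeights θ) tFiveEighths (ybCoeff θ) Dl (w.side .W) c ≠ 0 := by
  refine vertexFunctional_printed_cell_ne_zero_of_cone hθ Dl w c hf hh hc hr ((starRingEnd ℂ) (u₁ + u₂))
    (fun ω h hW => ?_) hex
  have e0 : ΩG.dirAt θ hr ω * phase (2 * π * ΩG.sectorOf hh θ hr ω) = ΩG.letterAt hh θ hr ω := rfl
  rw [e0]
  rcases h2 ω h hW with e | e
  · rw [e]; exact re_conj_add_mul_posL hn hsum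
  · rw [e, add_comm]; exact re_conj_add_mul_posL hn.symm (by rwa [add_comm])

/-- ★★★ **THE NON-ANTIPODAL TWO-LETTER LAW, criterion form**: under the same hypotheses `VF_D(w.side W, c) ≠ 0 ↔` a wound
class-`B2a` walk exists at `c` (the encircling criterion holds at every two-letter cell whose letters are not opposite).
[cite: GlazmanManolescu2019, Lemma 2.1 (statement, "in the form given in [Gl]")] [cite: Glazman2015WeightedSAW, Lemma 3.1 (proof, pp. 6–7)] -/
theorem vertexFunctional_printed_cell_ne_zero_iff_of_two_letters {θ : ℝ} (hθ : θ ∈ Set.Ioo (π / 3) (2 * π / 3))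
    (Dl : List Face) (w c : Face) (hf : c ∈ Dl) (hh : ((w.1 - 1, w.2) : Face) ∉ dom Dl)
    (hc : ∀ t, c.side t ≠ w.side .W) (hr : RootedFace (dom Dl) (w.side .W) c) {u₁ u₂ : ℂ} (hn : ‖u₁‖ = ‖u₂‖)
    (hsum : u₁ + u₂ ≠ 0)
    (h2 : ∀ (ω : ΩG (dom Dl) (w.side .W) c) (h : ω.IsB2a),
      ω.WE (fun _ => θ) ≠ excursionWinding θ ω.2.firstSideG (ω.z1 hr h) ω.1 →
        ΩG.letterAt hh θ hr ω = u₁ ∨ ΩG.letterAt hh θ hr ω = u₂) :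
    vertexFunctional (printedWeights θ) tFiveEighths (ybCoeff θ) Dl (w.side .W) c ≠ 0 ↔
      ∃ (ω : ΩG (dom Dl) (w.side .W) c) (h : ω.IsB2a),
        ω.WE (fun _ => θ) ≠ excursionWinding θ ω.2.firstSideG (ω.z1 hr h) ω.1 := by
  refine ⟨fun hne => ?_, vertexFunctional_printed_cell_ne_zero_of_two_letters hθ Dl w c hf hh hc hr hn hsum h2⟩
  by_contra hno
  push Not at hno
  exact hne (vertexFunctional_printed_cell_eq_zero_of_no_wound (Set.Ioo_subset_Icc_self hθ) Dl w c hf hh hc hr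
    fun ω h => by simpa using hno ω h)

/-- ★★★ **THE ANTIPODAL TWO-LETTER LAW.** If the wound class-`B2a` walks at `c` realise at most the two opposite letters
`u` and `−u` (`u ≠ 0`), then `VF_D(w.side W, c) = i·v(θ)·u·(M(u) − M(−u))` — the defect lies on one line and measures the
mass imbalance (the far-cell, lateral and three-door laws of the catalogue have this shape).
[cite: GlazmanManolescu2019, Lemma 2.1 (statement, "in the form given in [Gl]")] [cite: Glazman2015WeightedSAW, Lemma 3.1 (proof, pp. 6–7)] -/
theorem vertexFunctional_printed_cell_eq_of_antipodal_letters {θ : ℝ} (hθ : θ ∈ Set.Icc (π / 3) (2 * π / 3))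
    (Dl : List Face) (w c : Face) (hf : c ∈ Dl) (hh : ((w.1 - 1, w.2) : Face) ∉ dom Dl)
    (hc : ∀ t, c.side t ≠ w.side .W) (hr : RootedFace (dom Dl) (w.side .W) c) {u : ℂ} (hu : u ≠ 0)
    (h2 : ∀ (ω : ΩG (dom Dl) (w.side .W) c) (h : ω.IsB2a),
      ω.WE (fun _ => θ) ≠ excursionWinding θ ω.2.firstSideG (ω.z1 hr h) ω.1 →
        ΩG.letterAt hh θ hr ω = u ∨ ΩG.letterAt hh θ hr ω = -u) :
    vertexFunctional (printedWeights θ) tFiveEighths (ybCoeff θ) Dl (w.side .W) c =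
      Complex.I * (weightV θ : ℂ) * u * ((ΩG.letterMass hh θ hr u : ℂ) - (ΩG.letterMass hh θ hr (-u) : ℂ)) := by
  have hne : u ≠ -u := fun e => hu (by linear_combination e / 2)
  rw [vertexFunctional_printed_cell_eq_two_letters hθ Dl w c hf hh hc hr hne h2]; ring

/-- ★★ **THE ANTIPODAL TWO-LETTER LAW, zero set**: on `θ ∈ (π/3, 2π/3)`, `VF_D(w.side W, c) = 0 ↔ M(u) = M(−u)`.
[cite: GlazmanManolescu2019, Lemma 2.1 (statement, "in the form given in [Gl]")] [cite: Glazman2015WeightedSAW, Lemma 3.1 (proof, pp. 6–7)] -/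
theorem vertexFunctional_printed_cell_eq_zero_iff_of_antipodal_letters {θ : ℝ} (hθ : θ ∈ Set.Ioo (π / 3) (2 * π / 3))
    (Dl : List Face) (w c : Face) (hf : c ∈ Dl) (hh : ((w.1 - 1, w.2) : Face) ∉ dom Dl)
    (hc : ∀ t, c.side t ≠ w.side .W) (hr : RootedFace (dom Dl) (w.side .W) c) {u : ℂ} (hu : u ≠ 0)
    (h2 : ∀ (ω : ΩG (dom Dl) (w.side .W) c) (h : ω.IsB2a),
      ω.WE (fun _ => θ) ≠ excursionWinding θ ω.2.firstSideG (ω.z1 hr h) ω.1 →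
        ΩG.letterAt hh θ hr ω = u ∨ ΩG.letterAt hh θ hr ω = -u) :
    vertexFunctional (printedWeights θ) tFiveEighths (ybCoeff θ) Dl (w.side .W) c = 0 ↔
      ΩG.letterMass hh θ hr u = ΩG.letterMass hh θ hr (-u) := by
  have hv : (weightV θ : ℂ) ≠ 0 := by
    have hθ0 : θ ∈ Set.Ioo 0 π := ⟨by linarith [hθ.1, Real.pi_pos], by linarith [hθ.2, Real.pi_pos]⟩
    exact_mod_cast (weightV_pos_of_mem_Ioo hθ0).ne'
  rw [vertexFunctional_printed_cell_eq_of_antipodal_letters (Set.Ioo_subset_Icc_self hθ) Dl w c hf hh hc hr hu h2]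
  constructor
  · intro h0
    have h1 := (mul_eq_zero.1 h0).resolve_left (mul_ne_zero (mul_ne_zero Complex.I_ne_zero hv) hu)
    exact_mod_cast sub_eq_zero.1 h1
  · intro h; rw [h, sub_self, mul_zero]

/-! ### One table direction: the sector laws -/

/-- ★★★ **THE NON-ANTIPODAL TWO-SECTOR LAW (no cancellation).** On `θ ∈ (π/3, 2π/3)`: if every wound class-`B2a`
walk at `c` has table direction `u ≠ 0` and sector `n₁` or `n₂` with `n₂ − n₁ ≢ 4 (mod 8)`, then `VF_D(w.side W, c) ≠ 0`
as soon as one wound walk exists — two sectors of one pattern cancel only when they differ by `4` mod `8` (adjacent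
sectors, the commonest case beyond the ring, never cancel). [cite: GlazmanManolescu2019, Lemma 2.1 (statement) and §2.1 (σ = 5/8)]
[cite: Glazman2015WeightedSAW, Lemma 3.1 (proof, pp. 6–7)] -/
theorem vertexFunctional_printed_cell_ne_zero_of_two_sectors {θ : ℝ} (hθ : θ ∈ Set.Ioo (π / 3) (2 * π / 3))
    (Dl : List Face) (w c : Face) (hf : c ∈ Dl) (hh : ((w.1 - 1, w.2) : Face) ∉ dom Dl)
    (hc : ∀ t, c.side t ≠ w.side .W) (hr : RootedFace (dom Dl) (w.side .W) c) {u : ℂ} (hu : u ≠ 0) {n₁ n₂ : ℤ}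
    (hd : (n₂ - n₁) % 8 ≠ 4)
    (hdir : ∀ (ω : ΩG (dom Dl) (w.side .W) c) (h : ω.IsB2a),
      ω.WE (fun _ => θ) ≠ excursionWinding θ ω.2.firstSideG (ω.z1 hr h) ω.1 → ΩG.dirAt θ hr ω = u)
    (hS : ∀ (ω : ΩG (dom Dl) (w.side .W) c) (h : ω.IsB2a),
      ω.WE (fun _ => θ) ≠ excursionWinding θ ω.2.firstSideG (ω.z1 hr h) ω.1 →
        ΩG.sectorOf hh θ hr ω = n₁ ∨ ΩG.sectorOf hh θ hr ω = n₂)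
    (hex : ∃ (ω : ΩG (dom Dl) (w.side .W) c) (h : ω.IsB2a),
      ω.WE (fun _ => θ) ≠ excursionWinding θ ω.2.firstSideG (ω.z1 hr h) ω.1) :
    vertexFunctional (printedWeights θ) tFiveEighths (ybCoeff θ) Dl (w.side .W) c ≠ 0 := by
  have h2 : ∀ (ω : ΩG (dom Dl) (w.side .W) c) (h : ω.IsB2a),
      ω.WE (fun _ => θ) ≠ excursionWinding θ ω.2.firstSideG (ω.z1 hr h) ω.1 →
        ΩG.letterAt hh θ hr ω = u * phase (2 * π * n₁) ∨ ΩG.letterAt hh θ hr ω = u * phase (2 * π * n₂) := by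
    intro ω h hW
    simp only [ΩG.letterAt, hdir ω h hW]
    rcases hS ω h hW with e | e
    · exact Or.inl (by rw [e])
    · exact Or.inr (by rw [e])
  by_cases h12 : n₁ = n₂
  · subst h12
    refine vertexFunctional_printed_cell_ne_zero_of_aligned hθ Dl w c hf hh hc hr (u := u * phase (2 * π * n₁))
      (mul_ne_zero hu (phase_ne_zeroL _)) (fun ω h hW => ?_) hex
    rcases h2 ω h hW with e | e <;> exact e
  · have hζ : phase (2 * π * ((n₂ - n₁ : ℤ) : ℝ)) ≠ -1 := fun e => hd ((phase_two_pi_mul_eq_neg_one_iff _).1 e)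
    refine vertexFunctional_printed_cell_ne_zero_of_two_letters hθ Dl w c hf hh hc hr
      (u₁ := u * phase (2 * π * n₁)) (u₂ := u * phase (2 * π * n₂)) ?_ ?_ h2 hex
    · rw [norm_mul_phase_two_pi_mulL, norm_mul_phase_two_pi_mulL]
    · have e1 : u * phase (2 * π * n₁) + u * phase (2 * π * n₂) =
          u * phase (2 * π * n₁) * (1 + phase (2 * π * ((n₂ - n₁ : ℤ) : ℝ))) := by
        rw [phase_two_pi_mul_eq_mul_sub n₁ n₂]; ring
      rw [e1]
      exact mul_ne_zero (mul_ne_zero hu (phase_ne_zeroL _)) fun h0 => hζ (by linear_combination h0)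

/-- ★★★ **THE ANTIPODAL TWO-SECTOR LAW.** If every wound class-`B2a` walk at `c` has table direction `u` and sector
`n₁` or `n₂` with `n₂ − n₁ ≡ 4 (mod 8)`, then `VF_D(w.side W, c) = i·v(θ)·u·ζ^{n₁}·(M_{n₁} − M_{n₂})`, `θ ∈ [π/3, 2π/3]`.
[cite: GlazmanManolescu2019, Lemma 2.1 (statement) and §2.1 (σ = 5/8)] [cite: Glazman2015WeightedSAW, Lemma 3.1 (proof, pp. 6–7)] -/
theorem vertexFunctional_printed_cell_eq_of_antipodal_sectors {θ : ℝ} (hθ : θ ∈ Set.Icc (π / 3) (2 * π / 3))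
    (Dl : List Face) (w c : Face) (hf : c ∈ Dl) (hh : ((w.1 - 1, w.2) : Face) ∉ dom Dl)
    (hc : ∀ t, c.side t ≠ w.side .W) (hr : RootedFace (dom Dl) (w.side .W) c) (u : ℂ) {n₁ n₂ : ℤ}
    (hd : (n₂ - n₁) % 8 = 4)
    (hdir : ∀ (ω : ΩG (dom Dl) (w.side .W) c) (h : ω.IsB2a),
      ω.WE (fun _ => θ) ≠ excursionWinding θ ω.2.firstSideG (ω.z1 hr h) ω.1 → ΩG.dirAt θ hr ω = u)
    (hS : ∀ (ω : ΩG (dom Dl) (w.side .W) c) (h : ω.IsB2a),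
      ω.WE (fun _ => θ) ≠ excursionWinding θ ω.2.firstSideG (ω.z1 hr h) ω.1 →
        ΩG.sectorOf hh θ hr ω = n₁ ∨ ΩG.sectorOf hh θ hr ω = n₂) :
    vertexFunctional (printedWeights θ) tFiveEighths (ybCoeff θ) Dl (w.side .W) c =
      Complex.I * (weightV θ : ℂ) * (u * phase (2 * π * n₁)) *
        ((ΩG.sectorMass hh θ hr n₁ : ℂ) - (ΩG.sectorMass hh θ hr n₂ : ℂ)) := by
  classical
  have h12 : n₁ ≠ n₂ := by rintro rfl; simp at hd
  rw [vertexFunctional_printed_cell_eq_dir_mul_sum_sectorMass hθ Dl w c hf hh hc hr u {n₁, n₂} hdir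
    (fun ω h hW => by rcases hS ω h hW with e | e <;> simp [e]), Finset.sum_pair h12,
    phase_two_pi_mul_eq_mul_sub n₁ n₂, (phase_two_pi_mul_eq_neg_one_iff _).2 hd]
  ring

/-- ★★ **THE ANTIPODAL TWO-SECTOR LAW, zero set**: on `θ ∈ (π/3, 2π/3)` and for `u ≠ 0`,
`VF_D(w.side W, c) = 0 ↔ M_{n₁} = M_{n₂}`. [cite: GlazmanManolescu2019, Lemma 2.1 (statement) and §2.1 (σ = 5/8)]
[cite: Glazman2015WeightedSAW, Lemma 3.1 (proof, pp. 6–7)] -/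
theorem vertexFunctional_printed_cell_eq_zero_iff_of_antipodal_sectors {θ : ℝ} (hθ : θ ∈ Set.Ioo (π / 3) (2 * π / 3))
    (Dl : List Face) (w c : Face) (hf : c ∈ Dl) (hh : ((w.1 - 1, w.2) : Face) ∉ dom Dl)
    (hc : ∀ t, c.side t ≠ w.side .W) (hr : RootedFace (dom Dl) (w.side .W) c) {u : ℂ} (hu : u ≠ 0) {n₁ n₂ : ℤ}
    (hd : (n₂ - n₁) % 8 = 4)
    (hdir : ∀ (ω : ΩG (dom Dl) (w.side .W) c) (h : ω.IsB2a),
      ω.WE (fun _ => θ) ≠ excursionWinding θ ω.2.firstSideG (ω.z1 hr h) ω.1 → ΩG.dirAt θ hr ω = u)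
    (hS : ∀ (ω : ΩG (dom Dl) (w.side .W) c) (h : ω.IsB2a),
      ω.WE (fun _ => θ) ≠ excursionWinding θ ω.2.firstSideG (ω.z1 hr h) ω.1 →
        ΩG.sectorOf hh θ hr ω = n₁ ∨ ΩG.sectorOf hh θ hr ω = n₂) :
    vertexFunctional (printedWeights θ) tFiveEighths (ybCoeff θ) Dl (w.side .W) c = 0 ↔
      ΩG.sectorMass hh θ hr n₁ = ΩG.sectorMass hh θ hr n₂ := by
  have hv : (weightV θ : ℂ) ≠ 0 := by
    have hθ0 : θ ∈ Set.Ioo 0 π := ⟨by linarith [hθ.1, Real.pi_pos], by linarith [hθ.2, Real.pi_pos]⟩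
    exact_mod_cast (weightV_pos_of_mem_Ioo hθ0).ne'
  rw [vertexFunctional_printed_cell_eq_of_antipodal_sectors (Set.Ioo_subset_Icc_self hθ) Dl w c hf hh hc hr u hd hdir hS]
  constructor
  · intro h0
    have h1 := (mul_eq_zero.1 h0).resolve_left
      (mul_ne_zero (mul_ne_zero Complex.I_ne_zero hv) (mul_ne_zero hu (phase_ne_zeroL _)))
    exact_mod_cast sub_eq_zero.1 h1
  · intro h; rw [h, sub_self, mul_zero]

/-- ★★★ **THE THREE-SECTOR LAW.** If every wound class-`B2a` walk at `c` has table direction `u` and one of three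
CONSECUTIVE sectors `n₀ − 1, n₀, n₀ + 1`, then with `M₋, M₀, M₊` their masses and `ζ = phase(2π) = e^{−i5π/4}`:
`VF_D(w.side W, c) = i·v(θ)·u·ζ^{n₀}·(M₀ + ζ·M₊ + ζ⁻¹·M₋)`, `θ ∈ [π/3, 2π/3]`.
[cite: GlazmanManolescu2019, Lemma 2.1 (statement) and §2.1, eq. (2.1) (σ = 5/8)] [cite: Glazman2015WeightedSAW, Lemma 3.1 (proof, pp. 6–7)] -/
theorem vertexFunctional_printed_cell_eq_of_three_sectors {θ : ℝ} (hθ : θ ∈ Set.Icc (π / 3) (2 * π / 3))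
    (Dl : List Face) (w c : Face) (hf : c ∈ Dl) (hh : ((w.1 - 1, w.2) : Face) ∉ dom Dl)
    (hc : ∀ t, c.side t ≠ w.side .W) (hr : RootedFace (dom Dl) (w.side .W) c) (u : ℂ) (n₀ : ℤ)
    (hdir : ∀ (ω : ΩG (dom Dl) (w.side .W) c) (h : ω.IsB2a),
      ω.WE (fun _ => θ) ≠ excursionWinding θ ω.2.firstSideG (ω.z1 hr h) ω.1 → ΩG.dirAt θ hr ω = u)
    (hS : ∀ (ω : ΩG (dom Dl) (w.side .W) c) (h : ω.IsB2a),
      ω.WE (fun _ => θ) ≠ excursionWinding θ ω.2.firstSideG (ω.z1 hr h) ω.1 →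
        ΩG.sectorOf hh θ hr ω = n₀ - 1 ∨ ΩG.sectorOf hh θ hr ω = n₀ ∨ ΩG.sectorOf hh θ hr ω = n₀ + 1) :
    vertexFunctional (printedWeights θ) tFiveEighths (ybCoeff θ) Dl (w.side .W) c =
      Complex.I * (weightV θ : ℂ) * (u * phase (2 * π * n₀)) *
        ((ΩG.sectorMass hh θ hr n₀ : ℂ) + phase (2 * π) * (ΩG.sectorMass hh θ hr (n₀ + 1) : ℂ) +
          phase (-(2 * π)) * (ΩG.sectorMass hh θ hr (n₀ - 1) : ℂ)) := by
  classical
  have hn1 : n₀ - 1 ∉ ({n₀, n₀ + 1} : Finset ℤ) := by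
    simp only [Finset.mem_insert, Finset.mem_singleton]; omega
  have hn2 : n₀ ≠ n₀ + 1 := by omega
  rw [vertexFunctional_printed_cell_eq_dir_mul_sum_sectorMass hθ Dl w c hf hh hc hr u {n₀ - 1, n₀, n₀ + 1} hdir
    (fun ω h hW => by rcases hS ω h hW with e | e | e <;> simp [e]), Finset.sum_insert hn1, Finset.sum_pair hn2]
  have e1 : phase (2 * π * ((n₀ + 1 : ℤ) : ℝ)) = phase (2 * π * n₀) * phase (2 * π) := by
    rw [← phase_add]; congr 1; push_cast; ring
  have e2 : phase (2 * π * ((n₀ - 1 : ℤ) : ℝ)) = phase (2 * π * n₀) * phase (-(2 * π)) := by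
    rw [← phase_add]; congr 1; push_cast; ring
  rw [e1, e2]; ring

/-- ★★★ **THE THREE-SECTOR LAW, Cartesian form**: `M₀ + ζ·M₊ + ζ⁻¹·M₋ = (M₀ − (M₊ + M₋)/√2) + i·(M₊ − M₋)/√2`, so
`VF_D(w.side W, c) = i·v(θ)·u·ζ^{n₀}·[(M₀ − (M₊ + M₋)·(√2/2)) + i·(M₊ − M₋)·(√2/2)]`.
[cite: GlazmanManolescu2019, Lemma 2.1 (statement) and §2.1 (σ = 5/8)] [cite: Glazman2015WeightedSAW, Lemma 3.1 (proof, pp. 6–7)] -/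
theorem vertexFunctional_printed_cell_eq_of_three_sectors_cartesian {θ : ℝ} (hθ : θ ∈ Set.Icc (π / 3) (2 * π / 3))
    (Dl : List Face) (w c : Face) (hf : c ∈ Dl) (hh : ((w.1 - 1, w.2) : Face) ∉ dom Dl)
    (hc : ∀ t, c.side t ≠ w.side .W) (hr : RootedFace (dom Dl) (w.side .W) c) (u : ℂ) (n₀ : ℤ)
    (hdir : ∀ (ω : ΩG (dom Dl) (w.side .W) c) (h : ω.IsB2a),
      ω.WE (fun _ => θ) ≠ excursionWinding θ ω.2.firstSideG (ω.z1 hr h) ω.1 → ΩG.dirAt θ hr ω = u)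
    (hS : ∀ (ω : ΩG (dom Dl) (w.side .W) c) (h : ω.IsB2a),
      ω.WE (fun _ => θ) ≠ excursionWinding θ ω.2.firstSideG (ω.z1 hr h) ω.1 →
        ΩG.sectorOf hh θ hr ω = n₀ - 1 ∨ ΩG.sectorOf hh θ hr ω = n₀ ∨ ΩG.sectorOf hh θ hr ω = n₀ + 1) :
    vertexFunctional (printedWeights θ) tFiveEighths (ybCoeff θ) Dl (w.side .W) c =
      Complex.I * (weightV θ : ℂ) * (u * phase (2 * π * n₀)) *
        ⟨ΩG.sectorMass hh θ hr n₀ - (ΩG.sectorMass hh θ hr (n₀ + 1) + ΩG.sectorMass hh θ hr (n₀ - 1)) * (Real.sqrt 2 / 2),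
          (ΩG.sectorMass hh θ hr (n₀ + 1) - ΩG.sectorMass hh θ hr (n₀ - 1)) * (Real.sqrt 2 / 2)⟩ := by
  rw [vertexFunctional_printed_cell_eq_of_three_sectors hθ Dl w c hf hh hc hr u n₀ hdir hS, phase_two_pi, phase_neg_two_pi]
  congr 1
  apply Complex.ext <;> simp <;> ring

/-- ★★★ **THE THREE-SECTOR LAW, zero set**: on `θ ∈ (π/3, 2π/3)` and for `u ≠ 0`,
`VF_D(w.side W, c) = 0 ↔ (M₊ = M₋ ∧ M₀ = √2·M₊)` — two real conditions (codimension two).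
[cite: GlazmanManolescu2019, Lemma 2.1 (statement) and §2.1 (σ = 5/8)] [cite: Glazman2015WeightedSAW, Lemma 3.1 (proof, pp. 6–7)] -/
theorem vertexFunctional_printed_cell_eq_zero_iff_of_three_sectors {θ : ℝ} (hθ : θ ∈ Set.Ioo (π / 3) (2 * π / 3))
    (Dl : List Face) (w c : Face) (hf : c ∈ Dl) (hh : ((w.1 - 1, w.2) : Face) ∉ dom Dl)
    (hc : ∀ t, c.side t ≠ w.side .W) (hr : RootedFace (dom Dl) (w.side .W) c) {u : ℂ} (hu : u ≠ 0) (n₀ : ℤ)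
    (hdir : ∀ (ω : ΩG (dom Dl) (w.side .W) c) (h : ω.IsB2a),
      ω.WE (fun _ => θ) ≠ excursionWinding θ ω.2.firstSideG (ω.z1 hr h) ω.1 → ΩG.dirAt θ hr ω = u)
    (hS : ∀ (ω : ΩG (dom Dl) (w.side .W) c) (h : ω.IsB2a),
      ω.WE (fun _ => θ) ≠ excursionWinding θ ω.2.firstSideG (ω.z1 hr h) ω.1 →
        ΩG.sectorOf hh θ hr ω = n₀ - 1 ∨ ΩG.sectorOf hh θ hr ω = n₀ ∨ ΩG.sectorOf hh θ hr ω = n₀ + 1) :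
    vertexFunctional (printedWeights θ) tFiveEighths (ybCoeff θ) Dl (w.side .W) c = 0 ↔
      (ΩG.sectorMass hh θ hr (n₀ + 1) = ΩG.sectorMass hh θ hr (n₀ - 1) ∧
        ΩG.sectorMass hh θ hr n₀ = Real.sqrt 2 * ΩG.sectorMass hh θ hr (n₀ + 1)) := by
  have hv : (weightV θ : ℂ) ≠ 0 := by
    have hθ0 : θ ∈ Set.Ioo 0 π := ⟨by linarith [hθ.1, Real.pi_pos], by linarith [hθ.2, Real.pi_pos]⟩
    exact_mod_cast (weightV_pos_of_mem_Ioo hθ0).ne'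
  have hpre : Complex.I * (weightV θ : ℂ) * (u * phase (2 * π * n₀)) ≠ 0 :=
    mul_ne_zero (mul_ne_zero Complex.I_ne_zero hv) (mul_ne_zero hu (phase_ne_zeroL _))
  have hs2 : (0 : ℝ) < Real.sqrt 2 / 2 := by positivity
  have hsq : Real.sqrt 2 * Real.sqrt 2 = 2 := Real.mul_self_sqrt (by norm_num)
  rw [vertexFunctional_printed_cell_eq_of_three_sectors_cartesian (Set.Ioo_subset_Icc_self hθ) Dl w c hf hh hc hr u n₀
    hdir hS]
  set M₀ := ΩG.sectorMass hh θ hr n₀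
  set Mp := ΩG.sectorMass hh θ hr (n₀ + 1)
  set Mm := ΩG.sectorMass hh θ hr (n₀ - 1)
  constructor
  · intro h0
    have hz := (mul_eq_zero.1 h0).resolve_left hpre
    have hre := congrArg Complex.re hz
    have him := congrArg Complex.im hz
    simp only [Complex.zero_re, Complex.zero_im] at hre him
    have h1 : Mp = Mm := by
      have : (Mp - Mm) * (Real.sqrt 2 / 2) = 0 := him
      rcases mul_eq_zero.1 this with h | h
      · linarith
      · linarith
    refine ⟨h1, ?_⟩
    have : M₀ - (Mp + Mm) * (Real.sqrt 2 / 2) = 0 := hre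
    rw [← h1] at this
    nlinarith [this, hsq]
  · rintro ⟨h1, h2⟩
    rw [← h1, h2]
    have e : (⟨Real.sqrt 2 * Mp - (Mp + Mp) * (Real.sqrt 2 / 2), (Mp - Mp) * (Real.sqrt 2 / 2)⟩ : ℂ) = 0 := by
      apply Complex.ext
      · simp only [Complex.zero_re]; ring
      · simp
    rw [e, mul_zero]

/-- ★★ **THREE-SECTOR DOMINANCE**: if the middle sector dominates, `M₊ + M₋ < √2·M₀`, then `VF_D(w.side W, c) ≠ 0`
(`θ ∈ (π/3, 2π/3)`, `u ≠ 0`). [cite: GlazmanManolescu2019, Lemma 2.1 (statement) and §2.1 (σ = 5/8)]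
[cite: Glazman2015WeightedSAW, Lemma 3.1 (proof, pp. 6–7)] -/
theorem vertexFunctional_printed_cell_ne_zero_of_three_sectors_dominant {θ : ℝ} (hθ : θ ∈ Set.Ioo (π / 3) (2 * π / 3))
    (Dl : List Face) (w c : Face) (hf : c ∈ Dl) (hh : ((w.1 - 1, w.2) : Face) ∉ dom Dl)
    (hc : ∀ t, c.side t ≠ w.side .W) (hr : RootedFace (dom Dl) (w.side .W) c) {u : ℂ} (hu : u ≠ 0) (n₀ : ℤ)
    (hdir : ∀ (ω : ΩG (dom Dl) (w.side .W) c) (h : ω.IsB2a),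
      ω.WE (fun _ => θ) ≠ excursionWinding θ ω.2.firstSideG (ω.z1 hr h) ω.1 → ΩG.dirAt θ hr ω = u)
    (hS : ∀ (ω : ΩG (dom Dl) (w.side .W) c) (h : ω.IsB2a),
      ω.WE (fun _ => θ) ≠ excursionWinding θ ω.2.firstSideG (ω.z1 hr h) ω.1 →
        ΩG.sectorOf hh θ hr ω = n₀ - 1 ∨ ΩG.sectorOf hh θ hr ω = n₀ ∨ ΩG.sectorOf hh θ hr ω = n₀ + 1)
    (hdom : ΩG.sectorMass hh θ hr (n₀ + 1) + ΩG.sectorMass hh θ hr (n₀ - 1) < Real.sqrt 2 * ΩG.sectorMass hh θ hr n₀) :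
    vertexFunctional (printedWeights θ) tFiveEighths (ybCoeff θ) Dl (w.side .W) c ≠ 0 := by
  intro h0
  obtain ⟨h1, h2⟩ :=
    (vertexFunctional_printed_cell_eq_zero_iff_of_three_sectors hθ Dl w c hf hh hc hr hu n₀ hdir hS).1 h0
  have hsq : Real.sqrt 2 * Real.sqrt 2 = 2 := Real.mul_self_sqrt (by norm_num)
  rw [← h1, h2, ← mul_assoc, hsq] at hdom
  linarith

/-- ★★ **THREE-SECTOR SUB-DOMINANCE**: if the outer sectors dominate, `√2·M₀ < M₊ + M₋`, then `VF_D(w.side W, c) ≠ 0`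
(`θ ∈ (π/3, 2π/3)`, `u ≠ 0`). [cite: GlazmanManolescu2019, Lemma 2.1 (statement) and §2.1 (σ = 5/8)]
[cite: Glazman2015WeightedSAW, Lemma 3.1 (proof, pp. 6–7)] -/
theorem vertexFunctional_printed_cell_ne_zero_of_three_sectors_subdominant {θ : ℝ}
    (hθ : θ ∈ Set.Ioo (π / 3) (2 * π / 3))
    (Dl : List Face) (w c : Face) (hf : c ∈ Dl) (hh : ((w.1 - 1, w.2) : Face) ∉ dom Dl)
    (hc : ∀ t, c.side t ≠ w.side .W) (hr : RootedFace (dom Dl) (w.side .W) c) {u : ℂ} (hu : u ≠ 0) (n₀ : ℤ)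
    (hdir : ∀ (ω : ΩG (dom Dl) (w.side .W) c) (h : ω.IsB2a),
      ω.WE (fun _ => θ) ≠ excursionWinding θ ω.2.firstSideG (ω.z1 hr h) ω.1 → ΩG.dirAt θ hr ω = u)
    (hS : ∀ (ω : ΩG (dom Dl) (w.side .W) c) (h : ω.IsB2a),
      ω.WE (fun _ => θ) ≠ excursionWinding θ ω.2.firstSideG (ω.z1 hr h) ω.1 →
        ΩG.sectorOf hh θ hr ω = n₀ - 1 ∨ ΩG.sectorOf hh θ hr ω = n₀ ∨ ΩG.sectorOf hh θ hr ω = n₀ + 1)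
    (hsub : Real.sqrt 2 * ΩG.sectorMass hh θ hr n₀ < ΩG.sectorMass hh θ hr (n₀ + 1) + ΩG.sectorMass hh θ hr (n₀ - 1)) :
    vertexFunctional (printedWeights θ) tFiveEighths (ybCoeff θ) Dl (w.side .W) c ≠ 0 := by
  intro h0
  obtain ⟨h1, h2⟩ :=
    (vertexFunctional_printed_cell_eq_zero_iff_of_three_sectors hθ Dl w c hf hh hc hr hu n₀ hdir hS).1 h0
  have hsq : Real.sqrt 2 * Real.sqrt 2 = 2 := Real.mul_self_sqrt (by norm_num)
  rw [← h1, h2, ← mul_assoc, hsq] at hsub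
  linarith

/-- ★★ **THREE-SECTOR IMBALANCE**: if the outer sectors carry different masses, `M₊ ≠ M₋`, then `VF_D(w.side W, c) ≠ 0`
(`θ ∈ (π/3, 2π/3)`, `u ≠ 0`) — the defect leaves the line `i·v·u·ζ^{n₀}·ℝ`.
[cite: GlazmanManolescu2019, Lemma 2.1 (statement) and §2.1 (σ = 5/8)] [cite: Glazman2015WeightedSAW, Lemma 3.1 (proof, pp. 6–7)] -/
theorem vertexFunctional_printed_cell_ne_zero_of_three_sectors_of_ne {θ : ℝ} (hθ : θ ∈ Set.Ioo (π / 3) (2 * π / 3))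
    (Dl : List Face) (w c : Face) (hf : c ∈ Dl) (hh : ((w.1 - 1, w.2) : Face) ∉ dom Dl)
    (hc : ∀ t, c.side t ≠ w.side .W) (hr : RootedFace (dom Dl) (w.side .W) c) {u : ℂ} (hu : u ≠ 0) (n₀ : ℤ)
    (hdir : ∀ (ω : ΩG (dom Dl) (w.side .W) c) (h : ω.IsB2a),
      ω.WE (fun _ => θ) ≠ excursionWinding θ ω.2.firstSideG (ω.z1 hr h) ω.1 → ΩG.dirAt θ hr ω = u)
    (hS : ∀ (ω : ΩG (dom Dl) (w.side .W) c) (h : ω.IsB2a),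
      ω.WE (fun _ => θ) ≠ excursionWinding θ ω.2.firstSideG (ω.z1 hr h) ω.1 →
        ΩG.sectorOf hh θ hr ω = n₀ - 1 ∨ ΩG.sectorOf hh θ hr ω = n₀ ∨ ΩG.sectorOf hh θ hr ω = n₀ + 1)
    (hne : ΩG.sectorMass hh θ hr (n₀ + 1) ≠ ΩG.sectorMass hh θ hr (n₀ - 1)) :
    vertexFunctional (printedWeights θ) tFiveEighths (ybCoeff θ) Dl (w.side .W) c ≠ 0 := fun h0 =>
  hne ((vertexFunctional_printed_cell_eq_zero_iff_of_three_sectors hθ Dl w c hf hh hc hr hu n₀ hdir hS).1 h0).1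

/-- ★★★ **THE NON-ANTIPODAL TWO-SECTOR LAW, criterion form**: one table direction `u ≠ 0`, sectors in `{n₁, n₂}` with
`n₂ − n₁ ≢ 4 (mod 8)` ⇒ (`VF_D(w.side W, c) ≠ 0 ↔` a wound class-`B2a` walk exists at `c`), `θ ∈ (π/3, 2π/3)`.
[cite: GlazmanManolescu2019, Lemma 2.1 (statement) and §2.1 (σ = 5/8)] [cite: Glazman2015WeightedSAW, Lemma 3.1 (proof, pp. 6–7)] -/
theorem vertexFunctional_printed_cell_ne_zero_iff_of_two_sectors {θ : ℝ} (hθ : θ ∈ Set.Ioo (π / 3) (2 * π / 3))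
    (Dl : List Face) (w c : Face) (hf : c ∈ Dl) (hh : ((w.1 - 1, w.2) : Face) ∉ dom Dl)
    (hc : ∀ t, c.side t ≠ w.side .W) (hr : RootedFace (dom Dl) (w.side .W) c) {u : ℂ} (hu : u ≠ 0) {n₁ n₂ : ℤ}
    (hd : (n₂ - n₁) % 8 ≠ 4)
    (hdir : ∀ (ω : ΩG (dom Dl) (w.side .W) c) (h : ω.IsB2a),
      ω.WE (fun _ => θ) ≠ excursionWinding θ ω.2.firstSideG (ω.z1 hr h) ω.1 → ΩG.dirAt θ hr ω = u)
    (hS : ∀ (ω : ΩG (dom Dl) (w.side .W) c) (h : ω.IsB2a),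
      ω.WE (fun _ => θ) ≠ excursionWinding θ ω.2.firstSideG (ω.z1 hr h) ω.1 →
        ΩG.sectorOf hh θ hr ω = n₁ ∨ ΩG.sectorOf hh θ hr ω = n₂) :
    vertexFunctional (printedWeights θ) tFiveEighths (ybCoeff θ) Dl (w.side .W) c ≠ 0 ↔
      ∃ (ω : ΩG (dom Dl) (w.side .W) c) (h : ω.IsB2a),
        ω.WE (fun _ => θ) ≠ excursionWinding θ ω.2.firstSideG (ω.z1 hr h) ω.1 := by
  refine ⟨fun hne => ?_, vertexFunctional_printed_cell_ne_zero_of_two_sectors hθ Dl w c hf hh hc hr hu hd hdir hS⟩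
  by_contra hno
  push Not at hno
  exact hne (vertexFunctional_printed_cell_eq_zero_of_no_wound (Set.Ioo_subset_Icc_self hθ) Dl w c hf hh hc hr
    fun ω h => by simpa using hno ω h)

end Literature.Barriers.CriticalPhenomena.PlaquetteWalk

end

/-! ## (edition 2) Linear certificates: the cone-dominance law and the defect efficiency at any cell -/

noncomputable section

namespace Literature.Barriers.CriticalPhenomena.PlaquetteWalk

open Literature.Probability.RandomPlanarGeometry.SAW.YangBaxter
open Real Complex

/-- ★★★ **THE LINEAR CERTIFICATE LAW.** At any cell `c` of a `W`-normalised hole root (root not on `c`), `θ ∈ (π/3, 2π/3)`,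
letters of the wound class-`B2a` walks in the finite set `U`: if for some `ρ ∈ ℂ` the real-linear functional
`Σ_{u ∈ U} Re(conj(ρ)·u)·M(u)` is POSITIVE, then `VF_D(w.side W, c) ≠ 0` (it equals `Re(conj(ρ)·S)` for `VF = i·v·S`). This is
the form in which an all-`θ` non-vanishing certificate is checked: lower-bound the masses of the letters in a half-plane,
upper-bound the others. [cite: GlazmanManolescu2019, Lemma 2.1 (statement, "in the form given in [Gl]") and §2.1 (σ = 5/8)]
[cite: Glazman2015WeightedSAW, Lemma 3.1 (proof, pp. 6–7)] -/
theorem vertexFunctional_printed_cell_ne_zero_of_linear_certificate {θ : ℝ} (hθ : θ ∈ Set.Ioo (π / 3) (2 * π / 3))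
    (Dl : List Face) (w c : Face) (hf : c ∈ Dl) (hh : ((w.1 - 1, w.2) : Face) ∉ dom Dl)
    (hc : ∀ t, c.side t ≠ w.side .W) (hr : RootedFace (dom Dl) (w.side .W) c) (U : Finset ℂ)
    (hU : ∀ (ω : ΩG (dom Dl) (w.side .W) c) (h : ω.IsB2a),
      ω.WE (fun _ => θ) ≠ excursionWinding θ ω.2.firstSideG (ω.z1 hr h) ω.1 → ΩG.letterAt hh θ hr ω ∈ U)
    (ρ : ℂ) (hpos : 0 < ∑ u ∈ U, ((starRingEnd ℂ) ρ * u).re * ΩG.letterMass hh θ hr u) :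
    vertexFunctional (printedWeights θ) tFiveEighths (ybCoeff θ) Dl (w.side .W) c ≠ 0 := by
  have hv : (weightV θ : ℂ) ≠ 0 := by
    have hθ0 : θ ∈ Set.Ioo 0 π := ⟨by linarith [hθ.1, Real.pi_pos], by linarith [hθ.2, Real.pi_pos]⟩
    exact_mod_cast (weightV_pos_of_mem_Ioo hθ0).ne'
  rw [vertexFunctional_printed_cell_eq_sum_letterMass (Set.Ioo_subset_Icc_self hθ) Dl w c hf hh hc hr U hU]
  refine mul_ne_zero (mul_ne_zero Complex.I_ne_zero hv) fun h0 => ?_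
  have e : (((starRingEnd ℂ) ρ) * ∑ u ∈ U, u * (ΩG.letterMass hh θ hr u : ℂ)).re =
      ∑ u ∈ U, ((starRingEnd ℂ) ρ * u).re * ΩG.letterMass hh θ hr u := by
    rw [Finset.mul_sum, Complex.re_sum]
    refine Finset.sum_congr rfl fun u _ => ?_
    rw [← mul_assoc, Complex.re_mul_ofReal]
  rw [h0, mul_zero, Complex.zero_re] at e
  linarith

/-- ★★★ **THE CONE-DOMINANCE LAW.** Letters in `U`, all of modulus `≤ 1`; a unit `ρ` and a level `κ` (useful for `κ ∈ (0, 1]`): if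
`κ·(mass of the letters u with Re(conj(ρ)·u) ≥ κ) > (mass of the other letters)`, then `VF_D(w.side W, c) ≠ 0` — the wound
mass inside the cone of half-opening `arccos κ` around `ρ` outweighs everything outside. (Venture-lane census: at every cell with
three or more letters of the boxes up to `6 × 7` one narrow cone carries ≥ 88 % of the wound mass for every `θ`.)
[cite: GlazmanManolescu2019, Lemma 2.1 (statement) and §2.1 (σ = 5/8)] [cite: Glazman2015WeightedSAW, Lemma 3.1 (proof, pp. 6–7)] -/
theorem vertexFunctional_printed_cell_ne_zero_of_cone_dominance {θ : ℝ} (hθ : θ ∈ Set.Ioo (π / 3) (2 * π / 3))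
    (Dl : List Face) (w c : Face) (hf : c ∈ Dl) (hh : ((w.1 - 1, w.2) : Face) ∉ dom Dl)
    (hc : ∀ t, c.side t ≠ w.side .W) (hr : RootedFace (dom Dl) (w.side .W) c) (U : Finset ℂ)
    (hU1 : ∀ u ∈ U, ‖u‖ ≤ 1)
    (hU : ∀ (ω : ΩG (dom Dl) (w.side .W) c) (h : ω.IsB2a),
      ω.WE (fun _ => θ) ≠ excursionWinding θ ω.2.firstSideG (ω.z1 hr h) ω.1 → ΩG.letterAt hh θ hr ω ∈ U)
    {ρ : ℂ} (hρ : ‖ρ‖ = 1) {κ : ℝ}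
    (hdom : ∑ u ∈ U.filter (fun u => ¬ κ ≤ ((starRingEnd ℂ) ρ * u).re), ΩG.letterMass hh θ hr u <
      κ * ∑ u ∈ U.filter (fun u => κ ≤ ((starRingEnd ℂ) ρ * u).re), ΩG.letterMass hh θ hr u) :
    vertexFunctional (printedWeights θ) tFiveEighths (ybCoeff θ) Dl (w.side .W) c ≠ 0 := by
  classical
  have hθ' := Set.Ioo_subset_Icc_self hθ
  refine vertexFunctional_printed_cell_ne_zero_of_linear_certificate hθ Dl w c hf hh hc hr U hU ρ ?_
  have hM : ∀ u ∈ U, 0 ≤ ΩG.letterMass hh θ hr u := fun u _ => ΩG.letterMass_nonneg hh hθ' hr u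
  -- lower bound of each term: inside the cone `≥ κ·M`, outside `≥ −M` (|Re(conj ρ u)| ≤ ‖ρ‖‖u‖ ≤ 1)
  have hre : ∀ u ∈ U, -1 ≤ ((starRingEnd ℂ) ρ * u).re := by
    intro u hu
    have h1 : |((starRingEnd ℂ) ρ * u).re| ≤ ‖(starRingEnd ℂ) ρ * u‖ := Complex.abs_re_le_norm _
    rw [norm_mul, Complex.norm_conj, hρ, one_mul] at h1
    have h2 := hU1 u hu
    have h3 := neg_abs_le ((starRingEnd ℂ) ρ * u).re
    linarith
  rw [← Finset.sum_filter_add_sum_filter_not U (fun u => κ ≤ ((starRingEnd ℂ) ρ * u).re)]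
  have hin : κ * ∑ u ∈ U.filter (fun u => κ ≤ ((starRingEnd ℂ) ρ * u).re), ΩG.letterMass hh θ hr u ≤
      ∑ u ∈ U.filter (fun u => κ ≤ ((starRingEnd ℂ) ρ * u).re), ((starRingEnd ℂ) ρ * u).re * ΩG.letterMass hh θ hr u := by
    rw [Finset.mul_sum]
    refine Finset.sum_le_sum fun u hu => ?_
    rw [Finset.mem_filter] at hu
    exact mul_le_mul_of_nonneg_right hu.2 (hM u hu.1)
  have hout : -∑ u ∈ U.filter (fun u => ¬ κ ≤ ((starRingEnd ℂ) ρ * u).re), ΩG.letterMass hh θ hr u ≤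
      ∑ u ∈ U.filter (fun u => ¬ κ ≤ ((starRingEnd ℂ) ρ * u).re), ((starRingEnd ℂ) ρ * u).re * ΩG.letterMass hh θ hr u := by
    rw [← Finset.sum_neg_distrib]
    refine Finset.sum_le_sum fun u hu => ?_
    rw [Finset.mem_filter] at hu
    have := mul_le_mul_of_nonneg_right (hre u hu.1) (hM u hu.1)
    linarith
  linarith

/-- ★★ **THE DEFECT EFFICIENCY.** `‖VF_D(w.side W, c)‖ = v(θ)·‖Σ_{u ∈ U} u·M(u)‖` and, for every `ρ ≠ 0`,
`‖VF‖ ≥ v(θ)·(Σ_{u ∈ U} Re(conj(ρ)·u)·M(u))/‖ρ‖` — the linear certificate bounds the modulus of the defect from below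
(`θ ∈ [π/3, 2π/3]`). [cite: GlazmanManolescu2019, Lemma 2.1 (statement) and §2.1 (σ = 5/8)]
[cite: Glazman2015WeightedSAW, Lemma 3.1 (proof, pp. 6–7), eq. (1) (the weight v(θ))] -/
theorem norm_vertexFunctional_printed_cell_ge_linear {θ : ℝ} (hθ : θ ∈ Set.Icc (π / 3) (2 * π / 3))
    (Dl : List Face) (w c : Face) (hf : c ∈ Dl) (hh : ((w.1 - 1, w.2) : Face) ∉ dom Dl)
    (hc : ∀ t, c.side t ≠ w.side .W) (hr : RootedFace (dom Dl) (w.side .W) c) (U : Finset ℂ)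
    (hU : ∀ (ω : ΩG (dom Dl) (w.side .W) c) (h : ω.IsB2a),
      ω.WE (fun _ => θ) ≠ excursionWinding θ ω.2.firstSideG (ω.z1 hr h) ω.1 → ΩG.letterAt hh θ hr ω ∈ U)
    {ρ : ℂ} (hρ : ‖ρ‖ = 1) :
    weightV θ * ∑ u ∈ U, ((starRingEnd ℂ) ρ * u).re * ΩG.letterMass hh θ hr u ≤
      ‖vertexFunctional (printedWeights θ) tFiveEighths (ybCoeff θ) Dl (w.side .W) c‖ := by
  have hv0 : 0 < weightV θ :=
    weightV_pos_of_mem_Ioo ⟨by linarith [hθ.1, Real.pi_pos], by linarith [hθ.2, Real.pi_pos]⟩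
  set S := ∑ u ∈ U, u * (ΩG.letterMass hh θ hr u : ℂ) with hS
  have e : (((starRingEnd ℂ) ρ) * S).re = ∑ u ∈ U, ((starRingEnd ℂ) ρ * u).re * ΩG.letterMass hh θ hr u := by
    rw [hS, Finset.mul_sum, Complex.re_sum]
    refine Finset.sum_congr rfl fun u _ => ?_
    rw [← mul_assoc, Complex.re_mul_ofReal]
  have hre : (((starRingEnd ℂ) ρ) * S).re ≤ ‖S‖ := by
    have h1 := Complex.re_le_norm (((starRingEnd ℂ) ρ) * S)
    rw [norm_mul, Complex.norm_conj, hρ, one_mul] at h1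
    exact h1
  rw [vertexFunctional_printed_cell_eq_sum_letterMass hθ Dl w c hf hh hc hr U hU, ← hS, norm_mul, norm_mul,
    Complex.norm_I, one_mul, Complex.norm_real, Real.norm_of_nonneg hv0.le, ← e]
  exact mul_le_mul_of_nonneg_left hre hv0.le

end Literature.Barriers.CriticalPhenomena.PlaquetteWalk

end

/-! ## (edition 3) The eight residue masses of a one-pattern cell -/

noncomputable section

namespace Literature.Probability.RandomPlanarGeometry.SAW.YangBaxter

open Real Complex

/-! ### The eight powers of the sector unit -/

section EightPowers

/-- `phase(2π(n % 8)) = phase(2πn)`: reduce the sector to its residue. [cite: GlazmanManolescu2019, §2.1 (σ = 5/8)] -/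
theorem phase_two_pi_mul_emod_eight (n : ℤ) : phase (2 * π * ((n % 8 : ℤ) : ℝ)) = phase (2 * π * n) := by
  have h : n = n % 8 + 8 * (n / 8) := by omega
  conv_rhs => rw [h]
  exact (phase_two_pi_mul_add_eight_mul (n % 8) (n / 8)).symm

/-- Helper: a phase from its angle reduced mod `2π`. [folklore] -/
private theorem phase_two_pi_mul_eq_cexp_of (x a : ℝ) (m : ℤ) (h : -(5 * π * x / 4) = a + m * (2 * π)) :
    phase (2 * π * x) = Complex.exp ((a : ℂ) * Complex.I) := by
  have e : phase (2 * π * x) = Complex.exp (((-(5 * π * x / 4) : ℝ) : ℂ) * Complex.I) := by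
    rw [phase]; congr 2; push_cast; ring
  rw [e, Complex.exp_eq_exp_iff_exists_int]
  exact ⟨m, by rw [h]; push_cast; ring⟩

/-- `ζ⁰ = 1`. [cite: GlazmanManolescu2019, §2.1 (σ = 5/8)] -/
theorem phase_two_pi_mul_zero_real : phase (2 * π * 0) = 1 := by
  rw [phase]; simp

/-- `ζ¹ = (−1 + i)/√2`. [cite: GlazmanManolescu2019, §2.1 (σ = 5/8)] -/
theorem phase_two_pi_mul_one_real : phase (2 * π * 1) = ⟨-(Real.sqrt 2 / 2), Real.sqrt 2 / 2⟩ := by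
  rw [mul_one]; exact phase_two_pi

/-- `ζ² = −i`. [cite: GlazmanManolescu2019, §2.1 (σ = 5/8)] -/
theorem phase_two_pi_mul_two_real : phase (2 * π * 2) = -Complex.I := by
  rw [phase_two_pi_mul_eq_cexp_of 2 (-(π / 2)) (-1) (by ring), Complex.exp_mul_I, ← Complex.ofReal_cos, ← Complex.ofReal_sin,
    Real.cos_neg, Real.sin_neg, Real.cos_pi_div_two, Real.sin_pi_div_two]
  apply Complex.ext <;> simp

/-- `ζ³ = (1 + i)/√2`. [cite: GlazmanManolescu2019, §2.1 (σ = 5/8)] -/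
theorem phase_two_pi_mul_three_real : phase (2 * π * 3) = ⟨Real.sqrt 2 / 2, Real.sqrt 2 / 2⟩ := by
  rw [phase_two_pi_mul_eq_cexp_of 3 (π / 4) (-2) (by ring), Complex.exp_mul_I, ← Complex.ofReal_cos,
    ← Complex.ofReal_sin, Real.cos_pi_div_four, Real.sin_pi_div_four]
  apply Complex.ext <;> simp

/-- `ζ⁴ = −1`. [cite: GlazmanManolescu2019, §2.1 (σ = 5/8)] -/
theorem phase_two_pi_mul_four_real : phase (2 * π * 4) = -1 := by
  have h := (phase_two_pi_mul_eq_neg_one_iff 4).2 (by norm_num)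
  rwa [show ((4 : ℤ) : ℝ) = 4 by norm_num] at h

/-- `ζ⁵ = (1 − i)/√2`. [cite: GlazmanManolescu2019, §2.1 (σ = 5/8)] -/
theorem phase_two_pi_mul_five_real : phase (2 * π * 5) = ⟨Real.sqrt 2 / 2, -(Real.sqrt 2 / 2)⟩ := by
  rw [phase_two_pi_mul_eq_cexp_of 5 (-(π / 4)) (-3) (by ring), Complex.exp_mul_I, ← Complex.ofReal_cos,
    ← Complex.ofReal_sin, Real.cos_neg, Real.sin_neg, Real.cos_pi_div_four, Real.sin_pi_div_four]
  apply Complex.ext <;> simp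

/-- `ζ⁶ = i`. [cite: GlazmanManolescu2019, §2.1 (σ = 5/8)] -/
theorem phase_two_pi_mul_six_real : phase (2 * π * 6) = Complex.I := by
  rw [phase_two_pi_mul_eq_cexp_of 6 (π / 2) (-4) (by ring), Complex.exp_mul_I, ← Complex.ofReal_cos, ← Complex.ofReal_sin,
    Real.cos_pi_div_two, Real.sin_pi_div_two]
  simp

/-- `ζ⁷ = (−1 − i)/√2 = ζ⁻¹`. [cite: GlazmanManolescu2019, §2.1 (σ = 5/8)] -/
theorem phase_two_pi_mul_seven_real : phase (2 * π * 7) = ⟨-(Real.sqrt 2 / 2), -(Real.sqrt 2 / 2)⟩ := by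
  have hc : Real.cos (5 * π / 4) = -(Real.sqrt 2 / 2) := by
    rw [show 5 * π / 4 = π / 4 + π by ring, Real.cos_add_pi, Real.cos_pi_div_four]
  have hs : Real.sin (5 * π / 4) = -(Real.sqrt 2 / 2) := by
    rw [show 5 * π / 4 = π / 4 + π by ring, Real.sin_add_pi, Real.sin_pi_div_four]
  rw [phase_two_pi_mul_eq_cexp_of 7 (5 * π / 4) (-5) (by ring), Complex.exp_mul_I, ← Complex.ofReal_cos,
    ← Complex.ofReal_sin, hc, hs]
  apply Complex.ext <;> simp

end EightPowers

/-! ### Residue masses -/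

namespace ΩG

variable {D : Set Face} {w r : Face} [Finite D]

/-- Tool notion: **the residue mass** `R_j` (`j = 0, …, 7`) — the total wound mass of the class-`B2a` walks at `r` whose sector is
`≡ j (mod 8)`. [cite: GlazmanManolescu2019, §2.1, eq. (2.1) (wind(γ)) and Lemma 2.1] -/
noncomputable def residueMass (hh : ((w.1 - 1, w.2) : Face) ∉ D) (θ : ℝ) (hr : RootedFace D (w.side .W) r) (j : ℤ) : ℝ :=
  ∑ ω ∈ setB2a D (w.side .W) r, if sectorOf hh θ hr ω % 8 = j then woundMassAt θ hr ω else 0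

/-- Residue masses are non-negative on the printed range. [cite: GlazmanManolescu2019, eq. (1) (the weights are non-negative)] -/
theorem residueMass_nonneg (hh : ((w.1 - 1, w.2) : Face) ∉ D) {θ : ℝ} (hθ : θ ∈ Set.Icc (π / 3) (2 * π / 3))
    (hr : RootedFace D (w.side .W) r) (j : ℤ) : 0 ≤ residueMass hh θ hr j := by
  unfold residueMass
  exact Finset.sum_nonneg fun ω _ => by split_ifs; exacts [woundMassAt_nonneg hθ hr ω, le_rfl]

/-- ★★ **RESIDUE DECOMPOSITION (one direction, ANY sectors).** If every WOUND class-`B2a` walk at `r` has table direction `u`,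
then `Σ_{B2a} woundMassAt·dirAt·phase(2π·sectorOf) = u·Σ_{j=0}^{7} ζ^j·R_j` — no hypothesis on the sectors.
[cite: GlazmanManolescu2019, Lemma 2.1 (statement) and §2.1 (σ = 5/8)] [cite: Glazman2015WeightedSAW, Lemma 3.1 (proof, pp. 6–7)] -/
theorem sum_eq_dir_mul_sum_residueMass (hh : ((w.1 - 1, w.2) : Face) ∉ D) (θ : ℝ) (hr : RootedFace D (w.side .W) r)
    (u : ℂ)
    (hdir : ∀ (ω : ΩG D (w.side .W) r) (h : ω.IsB2a),
      ω.WE (fun _ => θ) ≠ excursionWinding θ ω.2.firstSideG (ω.z1 hr h) ω.1 → dirAt θ hr ω = u) :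
    ∑ ω ∈ setB2a D (w.side .W) r,
        (woundMassAt θ hr ω : ℂ) * dirAt θ hr ω * phase (2 * π * sectorOf hh θ hr ω) =
      u * ∑ j ∈ Finset.range 8, phase (2 * π * ((j : ℤ) : ℝ)) * (residueMass hh θ hr j : ℂ) := by
  classical
  have step : ∀ ω ∈ setB2a D (w.side .W) r,
      (woundMassAt θ hr ω : ℂ) * dirAt θ hr ω * phase (2 * π * sectorOf hh θ hr ω) =
        u * ∑ j ∈ Finset.range 8, phase (2 * π * ((j : ℤ) : ℝ)) *
          ((if sectorOf hh θ hr ω % 8 = (j : ℤ) then woundMassAt θ hr ω else 0 : ℝ) : ℂ) := by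
    intro ω _
    by_cases hm : woundMassAt θ hr ω = 0
    · rw [hm]; simp
    · obtain ⟨h, hW⟩ := exists_wound_of_woundMassAt_ne_zero hr ω hm
      set k := sectorOf hh θ hr ω with hk
      have hmem : (k % 8).toNat ∈ Finset.range 8 := by
        rw [Finset.mem_range]; omega
      have hcast : (((k % 8).toNat : ℕ) : ℤ) = k % 8 := by omega
      have e : ∀ j ∈ Finset.range 8, phase (2 * π * ((j : ℤ) : ℝ)) *
          ((if k % 8 = (j : ℤ) then woundMassAt θ hr ω else 0 : ℝ) : ℂ) =
          if j = (k % 8).toNat then phase (2 * π * ((k % 8 : ℤ) : ℝ)) * (woundMassAt θ hr ω : ℂ) else 0 := by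
        intro j _
        by_cases hj : j = (k % 8).toNat
        · subst hj; rw [hcast, if_pos rfl, if_pos rfl]
        · have : ¬ (k % 8 = (j : ℤ)) := fun e => hj (by omega)
          rw [if_neg this, if_neg hj]; simp
      rw [Finset.sum_congr rfl e, Finset.sum_ite_eq' (Finset.range 8) ((k % 8).toNat), if_pos hmem,
        phase_two_pi_mul_emod_eight, hdir ω h hW]
      ring
  rw [Finset.sum_congr rfl step, ← Finset.mul_sum, Finset.sum_comm]
  congr 1
  refine Finset.sum_congr rfl fun j _ => ?_
  rw [residueMass, Complex.ofReal_sum, Finset.mul_sum]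

end ΩG

end Literature.Probability.RandomPlanarGeometry.SAW.YangBaxter

namespace Literature.Barriers.CriticalPhenomena.PlaquetteWalk

open Literature.Probability.RandomPlanarGeometry.SAW.YangBaxter
open Real Complex

/-- ★★★ **THE EIGHT-RESIDUE LAW (one table direction, arbitrary sectors).** If every wound class-`B2a` walk at `c` has table
direction `u`, then with the residue masses `R_j` (`j = 0..7`):
`VF_D(w.side W, c) = i·v(θ)·u·Σ_{j=0}^{7} ζ^j·R_j`, `θ ∈ [π/3, 2π/3]` — the defect of a one-pattern cell is a function of eight
numbers, however many sectors occur (sectors are unbounded in general).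
[cite: GlazmanManolescu2019, Lemma 2.1 (statement) and §2.1, eq. (2.1) (wind(γ), σ = 5/8)] [cite: Glazman2015WeightedSAW, Lemma 3.1 (proof, pp. 6–7)] -/
theorem vertexFunctional_printed_cell_eq_dir_mul_sum_residueMass {θ : ℝ} (hθ : θ ∈ Set.Icc (π / 3) (2 * π / 3))
    (Dl : List Face) (w c : Face) (hf : c ∈ Dl) (hh : ((w.1 - 1, w.2) : Face) ∉ dom Dl)
    (hc : ∀ t, c.side t ≠ w.side .W) (hr : RootedFace (dom Dl) (w.side .W) c) (u : ℂ)
    (hdir : ∀ (ω : ΩG (dom Dl) (w.side .W) c) (h : ω.IsB2a),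
      ω.WE (fun _ => θ) ≠ excursionWinding θ ω.2.firstSideG (ω.z1 hr h) ω.1 → ΩG.dirAt θ hr ω = u) :
    vertexFunctional (printedWeights θ) tFiveEighths (ybCoeff θ) Dl (w.side .W) c =
      Complex.I * (weightV θ : ℂ) * u *
        ∑ j ∈ Finset.range 8, phase (2 * π * ((j : ℤ) : ℝ)) * (ΩG.residueMass hh θ hr j : ℂ) := by
  rw [vertexFunctional_printed_cell_eq_universal hθ Dl w c hf hh hc hr, ΩG.sum_eq_dir_mul_sum_residueMass hh θ hr u hdir]
  ring

/-- ★★★ **THE EIGHT-RESIDUE LAW, Cartesian form.** With `R_j` the residue masses,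
`Σ_{j=0}^{7} ζ^j·R_j = [(R₀ − R₄) + (R₃ + R₅ − R₁ − R₇)·(√2/2)] + i·[(R₆ − R₂) + (R₁ + R₃ − R₅ − R₇)·(√2/2)]`, so
`VF_D(w.side W, c)` is `i·v(θ)·u` times this explicit complex number (`θ ∈ [π/3, 2π/3]`); it vanishes iff both brackets do —
two real linear conditions on the eight residue masses. [cite: GlazmanManolescu2019, Lemma 2.1 (statement) and §2.1 (σ = 5/8)]
[cite: Glazman2015WeightedSAW, Lemma 3.1 (proof, pp. 6–7)] -/
theorem vertexFunctional_printed_cell_eq_residue_cartesian {θ : ℝ} (hθ : θ ∈ Set.Icc (π / 3) (2 * π / 3))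
    (Dl : List Face) (w c : Face) (hf : c ∈ Dl) (hh : ((w.1 - 1, w.2) : Face) ∉ dom Dl)
    (hc : ∀ t, c.side t ≠ w.side .W) (hr : RootedFace (dom Dl) (w.side .W) c) (u : ℂ)
    (hdir : ∀ (ω : ΩG (dom Dl) (w.side .W) c) (h : ω.IsB2a),
      ω.WE (fun _ => θ) ≠ excursionWinding θ ω.2.firstSideG (ω.z1 hr h) ω.1 → ΩG.dirAt θ hr ω = u) :
    vertexFunctional (printedWeights θ) tFiveEighths (ybCoeff θ) Dl (w.side .W) c =
      Complex.I * (weightV θ : ℂ) * u *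
        ⟨(ΩG.residueMass hh θ hr 0 - ΩG.residueMass hh θ hr 4) +
            (ΩG.residueMass hh θ hr 3 + ΩG.residueMass hh θ hr 5 - ΩG.residueMass hh θ hr 1 - ΩG.residueMass hh θ hr 7) *
              (Real.sqrt 2 / 2),
          (ΩG.residueMass hh θ hr 6 - ΩG.residueMass hh θ hr 2) +
            (ΩG.residueMass hh θ hr 1 + ΩG.residueMass hh θ hr 3 - ΩG.residueMass hh θ hr 5 - ΩG.residueMass hh θ hr 7) *
              (Real.sqrt 2 / 2)⟩ := by
  rw [vertexFunctional_printed_cell_eq_dir_mul_sum_residueMass hθ Dl w c hf hh hc hr u hdir]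
  congr 1
  simp only [Finset.sum_range_succ, Finset.sum_range_zero, zero_add]
  push_cast
  rw [phase_two_pi_mul_zero_real, phase_two_pi_mul_one_real, phase_two_pi_mul_two_real, phase_two_pi_mul_three_real,
    phase_two_pi_mul_four_real, phase_two_pi_mul_five_real, phase_two_pi_mul_six_real, phase_two_pi_mul_seven_real]
  apply Complex.ext <;> simp <;> ring

end Literature.Barriers.CriticalPhenomena.PlaquetteWalk

end

/-! ## (edition 4) The zero set as two real conditions; completeness of linear certificates -/

noncomputable section

namespace Literature.Barriers.CriticalPhenomena.PlaquetteWalk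

open Literature.Probability.RandomPlanarGeometry.SAW.YangBaxter
open Real Complex

/-- ★★★ **THE TWO-CONDITIONS LAW (the zero set at any cell).** On `θ ∈ (π/3, 2π/3)`, letters of the wound class-`B2a` walks in
the finite set `U`: `VF_D(w.side W, c) = 0 ↔ (Σ_{u ∈ U} Re(u)·M(u) = 0 ∧ Σ_{u ∈ U} Im(u)·M(u) = 0)` — vanishing of the vertex defect
is exactly TWO real linear conditions on the letter masses (codimension two in general; one when the letters are collinear, e.g.
two antipodal letters). [cite: GlazmanManolescu2019, Lemma 2.1 (statement, "in the form given in [Gl]") and §2.1 (σ = 5/8)]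
[cite: Glazman2015WeightedSAW, Lemma 3.1 (proof, pp. 6–7)] -/
theorem vertexFunctional_printed_cell_eq_zero_iff_re_im {θ : ℝ} (hθ : θ ∈ Set.Ioo (π / 3) (2 * π / 3))
    (Dl : List Face) (w c : Face) (hf : c ∈ Dl) (hh : ((w.1 - 1, w.2) : Face) ∉ dom Dl)
    (hc : ∀ t, c.side t ≠ w.side .W) (hr : RootedFace (dom Dl) (w.side .W) c) (U : Finset ℂ)
    (hU : ∀ (ω : ΩG (dom Dl) (w.side .W) c) (h : ω.IsB2a),
      ω.WE (fun _ => θ) ≠ excursionWinding θ ω.2.firstSideG (ω.z1 hr h) ω.1 → ΩG.letterAt hh θ hr ω ∈ U) :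
    vertexFunctional (printedWeights θ) tFiveEighths (ybCoeff θ) Dl (w.side .W) c = 0 ↔
      (∑ u ∈ U, u.re * ΩG.letterMass hh θ hr u = 0 ∧ ∑ u ∈ U, u.im * ΩG.letterMass hh θ hr u = 0) := by
  have hv : (weightV θ : ℂ) ≠ 0 := by
    have hθ0 : θ ∈ Set.Ioo 0 π := ⟨by linarith [hθ.1, Real.pi_pos], by linarith [hθ.2, Real.pi_pos]⟩
    exact_mod_cast (weightV_pos_of_mem_Ioo hθ0).ne'
  rw [vertexFunctional_printed_cell_eq_sum_letterMass (Set.Ioo_subset_Icc_self hθ) Dl w c hf hh hc hr U hU]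
  have hre : (∑ u ∈ U, u * (ΩG.letterMass hh θ hr u : ℂ)).re = ∑ u ∈ U, u.re * ΩG.letterMass hh θ hr u := by
    rw [Complex.re_sum]; exact Finset.sum_congr rfl fun u _ => by rw [Complex.re_mul_ofReal]
  have him : (∑ u ∈ U, u * (ΩG.letterMass hh θ hr u : ℂ)).im = ∑ u ∈ U, u.im * ΩG.letterMass hh θ hr u := by
    rw [Complex.im_sum]; exact Finset.sum_congr rfl fun u _ => by rw [Complex.im_mul_ofReal]
  constructor
  · intro h0
    have hS := (mul_eq_zero.1 h0).resolve_left (mul_ne_zero Complex.I_ne_zero hv)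
    exact ⟨by rw [← hre, hS, Complex.zero_re], by rw [← him, hS, Complex.zero_im]⟩
  · rintro ⟨h1, h2⟩
    have hS : ∑ u ∈ U, u * (ΩG.letterMass hh θ hr u : ℂ) = 0 := Complex.ext (by rw [hre, h1]; rfl) (by rw [him, h2]; rfl)
    rw [hS, mul_zero]

/-- ★★★ **COMPLETENESS OF LINEAR CERTIFICATES.** On `θ ∈ (π/3, 2π/3)`, letters in `U`: `VF_D(w.side W, c) ≠ 0 ↔ ∃ ρ ∈ ℂ,
0 < Σ_{u ∈ U} Re(conj(ρ)·u)·M(u)` — the linear-certificate law of edition 2 is not only sound but complete (take `ρ = S` itself: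
`Re(conj(S)·S) = |S|²`). [cite: GlazmanManolescu2019, Lemma 2.1 (statement) and §2.1 (σ = 5/8)]
[cite: Glazman2015WeightedSAW, Lemma 3.1 (proof, pp. 6–7)] -/
theorem vertexFunctional_printed_cell_ne_zero_iff_exists_linear_certificate {θ : ℝ} (hθ : θ ∈ Set.Ioo (π / 3) (2 * π / 3))
    (Dl : List Face) (w c : Face) (hf : c ∈ Dl) (hh : ((w.1 - 1, w.2) : Face) ∉ dom Dl)
    (hc : ∀ t, c.side t ≠ w.side .W) (hr : RootedFace (dom Dl) (w.side .W) c) (U : Finset ℂ)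
    (hU : ∀ (ω : ΩG (dom Dl) (w.side .W) c) (h : ω.IsB2a),
      ω.WE (fun _ => θ) ≠ excursionWinding θ ω.2.firstSideG (ω.z1 hr h) ω.1 → ΩG.letterAt hh θ hr ω ∈ U) :
    vertexFunctional (printedWeights θ) tFiveEighths (ybCoeff θ) Dl (w.side .W) c ≠ 0 ↔
      ∃ ρ : ℂ, 0 < ∑ u ∈ U, ((starRingEnd ℂ) ρ * u).re * ΩG.letterMass hh θ hr u := by
  refine ⟨fun hne => ?_, fun ⟨ρ, hρ⟩ =>
    vertexFunctional_printed_cell_ne_zero_of_linear_certificate hθ Dl w c hf hh hc hr U hU ρ hρ⟩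
  have hv : (weightV θ : ℂ) ≠ 0 := by
    have hθ0 : θ ∈ Set.Ioo 0 π := ⟨by linarith [hθ.1, Real.pi_pos], by linarith [hθ.2, Real.pi_pos]⟩
    exact_mod_cast (weightV_pos_of_mem_Ioo hθ0).ne'
  rw [vertexFunctional_printed_cell_eq_sum_letterMass (Set.Ioo_subset_Icc_self hθ) Dl w c hf hh hc hr U hU] at hne
  set S := ∑ u ∈ U, u * (ΩG.letterMass hh θ hr u : ℂ) with hS
  have hS0 : S ≠ 0 := fun h0 => hne (by rw [h0, mul_zero])
  refine ⟨S, ?_⟩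
  have e : ∑ u ∈ U, ((starRingEnd ℂ) S * u).re * ΩG.letterMass hh θ hr u = (((starRingEnd ℂ) S) * S).re := by
    rw [hS, Finset.mul_sum, Complex.re_sum]
    refine Finset.sum_congr rfl fun u _ => ?_
    rw [← mul_assoc, Complex.re_mul_ofReal]
  rw [e, ← Complex.normSq_eq_conj_mul_self, Complex.ofReal_re]
  exact Complex.normSq_pos.2 hS0

end Literature.Barriers.CriticalPhenomena.PlaquetteWalk

end

/-! ## (edition 5) Endpoint zero-mass laws: at `θ = π/3` (resp. `2π/3`) a cell all of whose wound walks pass a two-co-arc (resp. two-θ-arc) rhombus has zero defect -/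

noncomputable section

namespace Literature.Probability.RandomPlanarGeometry.SAW.YangBaxter

open Real Complex

namespace ΩG

variable {D : Set Face} {a : MidEdge} {r : Face}

/-- At `θ = π/3` a walk visiting a rhombus `g ≠ r` with two co-corner arcs has exterior weight `0` (`w₂(π/3) = 0`).
[cite: GlazmanManolescu2019, §1, eq. (1) and Fig. 1] -/
theorem extWeight_pi_div_three_eq_zero_of_coCorner_face (ω : ΩG D a r) {g : Face} (hg : g ∈ ω.2.facesVisited)
    (hgr : g ≠ r) (hk : ω.2.kindsIn g = [.coCorner, .coCorner]) : ω.2.extWeight (fun _ => π / 3) r = 0 := by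
  unfold YBWalk.extWeight
  exact Finset.prod_eq_zero (Finset.mem_erase.2 ⟨hgr, hg⟩) (by rw [hk]; simp [localWeight, weightW2_pi_div_three])

/-- At `θ = 2π/3` a walk visiting a rhombus `g ≠ r` with two `θ`-corner arcs has exterior weight `0` (`w₁(2π/3) = 0`).
[cite: GlazmanManolescu2019, §1, eq. (1) and Fig. 1] -/
theorem extWeight_two_pi_div_three_eq_zero_of_corner_face (ω : ΩG D a r) {g : Face} (hg : g ∈ ω.2.facesVisited)
    (hgr : g ≠ r) (hk : ω.2.kindsIn g = [.corner, .corner]) : ω.2.extWeight (fun _ => 2 * π / 3) r = 0 := by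
  unfold YBWalk.extWeight
  exact Finset.prod_eq_zero (Finset.mem_erase.2 ⟨hgr, hg⟩) (by rw [hk]; simp [localWeight, weightW1_two_pi_div_three])

/-- A wound mass vanishes with the exterior weight. [cite: Glazman2015WeightedSAW, Lemma 3.1 (proof, pp. 6–7)] -/
theorem woundMassAt_eq_zero_of_extWeight {θ : ℝ} (hr : RootedFace D a r) (ω : ΩG D a r)
    (h0 : ω.2.extWeight (fun _ => θ) r = 0) : woundMassAt θ hr ω = 0 := by
  unfold woundMassAt; split_ifs <;> first | exact h0 | rfl

end ΩG

end Literature.Probability.RandomPlanarGeometry.SAW.YangBaxter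

namespace Literature.Barriers.CriticalPhenomena.PlaquetteWalk

open Literature.Probability.RandomPlanarGeometry.SAW.YangBaxter
open Real Complex

/-- ★★ **ENDPOINT ZERO-MASS LAW at `θ = π/3`.** If every wound class-`B2a` walk at the cell `c` of a `W`-normalised hole root visits some
rhombus `g ≠ c` carrying two co-corner arcs, then `VF_D(w.side W, c) = 0` at `θ = π/3` — every wound mass contains the factor `w₂(π/3) = 0`.
(This is zero MASS, not cancellation: such cells do carry wound walks; venture-lane census: the only non-far-cell zeros found on 25 domains are of
this kind, at the endpoints.) [cite: GlazmanManolescu2019, Lemma 2.1 (statement) and §1, eq. (1)] [cite: Glazman2015WeightedSAW, Lemma 3.1 (proof, pp. 6–7)] -/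
theorem vertexFunctional_printed_cell_pi_div_three_eq_zero_of_coCorner_faces
    (Dl : List Face) (w c : Face) (hf : c ∈ Dl) (hh : ((w.1 - 1, w.2) : Face) ∉ dom Dl)
    (hc : ∀ t, c.side t ≠ w.side .W) (hr : RootedFace (dom Dl) (w.side .W) c)
    (hfaces : ∀ (ω : ΩG (dom Dl) (w.side .W) c) (h : ω.IsB2a),
      ω.WE (fun _ => π / 3) ≠ excursionWinding (π / 3) ω.2.firstSideG (ω.z1 hr h) ω.1 →
        ∃ g ∈ ω.2.facesVisited, g ≠ c ∧ ω.2.kindsIn g = [.coCorner, .coCorner]) :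
    vertexFunctional (printedWeights (π / 3)) tFiveEighths (ybCoeff (π / 3)) Dl (w.side .W) c = 0 := by
  classical
  have hθ : π / 3 ∈ Set.Icc (π / 3) (2 * π / 3) := ⟨le_rfl, by linarith [Real.pi_pos]⟩
  rw [vertexFunctional_printed_cell_eq_universal hθ Dl w c hf hh hc hr]
  refine mul_eq_zero_of_right _ (Finset.sum_eq_zero fun ω _ => ?_)
  have h0 : ΩG.woundMassAt (π / 3) hr ω = 0 := by
    by_contra hm
    obtain ⟨h, hW⟩ := ΩG.exists_wound_of_woundMassAt_ne_zero hr ω hm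
    obtain ⟨g, hg, hgr, hk⟩ := hfaces ω h hW
    exact hm (ΩG.woundMassAt_eq_zero_of_extWeight hr ω (ω.extWeight_pi_div_three_eq_zero_of_coCorner_face hg hgr hk))
  rw [h0]; simp

/-- ★★ **ENDPOINT ZERO-MASS LAW at `θ = 2π/3`** (the mirror statement: two `θ`-corner arcs, `w₁(2π/3) = 0`).
[cite: GlazmanManolescu2019, Lemma 2.1 (statement) and §1, eq. (1)] [cite: Glazman2015WeightedSAW, Lemma 3.1 (proof, pp. 6–7)] -/
theorem vertexFunctional_printed_cell_two_pi_div_three_eq_zero_of_corner_faces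
    (Dl : List Face) (w c : Face) (hf : c ∈ Dl) (hh : ((w.1 - 1, w.2) : Face) ∉ dom Dl)
    (hc : ∀ t, c.side t ≠ w.side .W) (hr : RootedFace (dom Dl) (w.side .W) c)
    (hfaces : ∀ (ω : ΩG (dom Dl) (w.side .W) c) (h : ω.IsB2a),
      ω.WE (fun _ => 2 * π / 3) ≠ excursionWinding (2 * π / 3) ω.2.firstSideG (ω.z1 hr h) ω.1 →
        ∃ g ∈ ω.2.facesVisited, g ≠ c ∧ ω.2.kindsIn g = [.corner, .corner]) :
    vertexFunctional (printedWeights (2 * π / 3)) tFiveEighths (ybCoeff (2 * π / 3)) Dl (w.side .W) c = 0 := by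
  classical
  have hθ : 2 * π / 3 ∈ Set.Icc (π / 3) (2 * π / 3) := ⟨by linarith [Real.pi_pos], le_rfl⟩
  rw [vertexFunctional_printed_cell_eq_universal hθ Dl w c hf hh hc hr]
  refine mul_eq_zero_of_right _ (Finset.sum_eq_zero fun ω _ => ?_)
  have h0 : ΩG.woundMassAt (2 * π / 3) hr ω = 0 := by
    by_contra hm
    obtain ⟨h, hW⟩ := ΩG.exists_wound_of_woundMassAt_ne_zero hr ω hm
    obtain ⟨g, hg, hgr, hk⟩ := hfaces ω h hW
    exact hm (ΩG.woundMassAt_eq_zero_of_extWeight hr ω (ω.extWeight_two_pi_div_three_eq_zero_of_corner_face hg hgr hk))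
  rw [h0]; simp

end Literature.Barriers.CriticalPhenomena.PlaquetteWalk

end
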